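import Mathlib
import HarnessLib
import Summits.ValiantsHypothesis.ValiantsHypothesis.Statement
import Summits.ValiantsHypothesis.ValiantsHypothesis.Theses.PermanentalCones
import Summits.ValiantsHypothesis.ValiantsHypothesis.Theorems.PermanentalConesDetToVP
import Literature.Computability.AlgebraicComplexity.DeterminantalComplexityProofs
import Literature.Computability.AlgebraicComplexity.VPDeterminantalQPProofs
import Summits.ValiantsHypothesis.ValiantsHypothesis.Theorems.PermanentalConesHyperbolicVPShadowStubLinearRealSpectrumNormalForm
import Summits.ValiantsHypothesis.ValiantsHypothesis.Theorems.PermanentalConesHyperbolicVPShadowIrreducibleReduction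
import Summits.ValiantsHypothesis.ValiantsHypothesis.Theorems.PermanentalConesHyperbolicVPShadowNetzerSanyal
import Literature.AlgebraicGeometry.DeterminantalHypersurfaces.HeltonVinnikov
import Literature.AlgebraicGeometry.DeterminantalHypersurfaces.HeltonVinnikovProofs
import Summits.ValiantsHypothesis.ValiantsHypothesis.Theorems.PermanentalConesHyperbolicVPShadowStubTernaryPencilHyperbolicForm
import Summits.ValiantsHypothesis.ValiantsHypothesis.Theorems.PermanentalConesHyperbolicVPShadowStubSpectrahedronOfSymmDetIdentity
import Summits.ValiantsHypothesis.ValiantsHypothesis.Theorems.PermanentalConesHyperbolicVPShadowStubLowEffGlue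
import Summits.ValiantsHypothesis.ValiantsHypothesis.Theorems.PermanentalConesHyperbolicVPShadowStubSpanDimLeThreeOfLeTwo
import Summits.ValiantsHypothesis.ValiantsHypothesis.Theorems.PermanentalConesHyperbolicVPShadowStubHighLayerInhabited
import Summits.ValiantsHypothesis.ValiantsHypothesis.Theorems.PermanentalConesHyperbolicVPShadowStubSpectrahedronOfSymmDetPower
import Summits.ValiantsHypothesis.ValiantsHypothesis.Theorems.PermanentalConesHyperbolicVPShadowStubFramePencilHyperbolicForm
import Summits.ValiantsHypothesis.ValiantsHypothesis.Theorems.PermanentalConesHyperbolicVPShadowStubRealifyHermitianPencil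
import Summits.ValiantsHypothesis.ValiantsHypothesis.Theorems.PermanentalConesHyperbolicVPShadowStubHighEffNetzerSanyal
import Summits.ValiantsHypothesis.ValiantsHypothesis.Theorems.PermanentalConesHyperbolicVPShadowStubOshimeFamily1Spectrahedron
import Summits.ValiantsHypothesis.ValiantsHypothesis.Theorems.PermanentalConesHyperbolicVPShadowStubOshimeFamily2Spectrahedron
import Summits.ValiantsHypothesis.ValiantsHypothesis.Theorems.PermanentalConesHyperbolicVPShadowStubOshimeFamily1hSpectrahedron
import Summits.ValiantsHypothesis.ValiantsHypothesis.Theorems.PermanentalConesHyperbolicVPShadowStubOshimeFamily2hSpectrahedron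
import Summits.ValiantsHypothesis.ValiantsHypothesis.Theorems.PermanentalConesHyperbolicVPShadowStubOshimeFamilyIhSpectrahedron
import Summits.ValiantsHypothesis.ValiantsHypothesis.Theorems.PermanentalConesHyperbolicVPShadowStubOshimeFamilyThSpectrahedron
import Summits.ValiantsHypothesis.ValiantsHypothesis.Theorems.PermanentalConesHyperbolicVPShadowStubOshimeFamilyD3hSpectrahedron
import Summits.ValiantsHypothesis.ValiantsHypothesis.Theorems.PermanentalConesHyperbolicVPShadowStubOshimeFamilyD4hSpectrahedron
import Summits.ValiantsHypothesis.ValiantsHypothesis.Theorems.PermanentalConesHyperbolicVPShadowStubOshimeFamilyD5hSpectrahedron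
import Summits.ValiantsHypothesis.ValiantsHypothesis.Theorems.PermanentalConesHyperbolicVPShadowStubConeOfConjPreimage
import Summits.ValiantsHypothesis.ValiantsHypothesis.Theorems.PermanentalConesHyperbolicVPShadowStubOshimeFamilyTleSpectrahedron
import Summits.ValiantsHypothesis.ValiantsHypothesis.Theorems.PermanentalConesHyperbolicVPShadowStubHighEffN3OfOshimeClassification

/-!
# Birth skeleton (BC3) — crux `HyperbolicVPShadow` (item `stmt-ValiantsHypothesis-8655`,
route `PermanentalCones`, rank 5: HT, family form)

Line: REAL-SPECTRUM NORMAL FORM. The crux says: every real `VP_ℂ` family of homogeneous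
polynomials hyperbolic w.r.t. `e_n` has closed hyperbolicity cones that are lifted-LMI sets
(spectrahedral shadows) of quasi-polynomial size. The skeleton separates

* `stub_linearRealSpectrumNormalForm` (M-sized, linear algebra over `ℝ[x]`): an AFFINE real
  pencil `M` (`N × N`) whose determinant `g` is homogeneous and hyperbolic w.r.t. `e` is replaced
  by the LINEAR pencil `P x := M(e)⁻¹ · L(x)` (`L` = linear part of `M`; homogenise with a slack
  variable `t`, `det (t·M₀ + L(x)) = t^(N − deg g) · g(x)`, normalise at `(e, 1)`, set `t = 0`):
  every `P x` has only real eigenvalues and `det (P x + τ·1) = τ^(N − deg g) g(x + τ e) / g(e)`,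
  so the closed "no negative eigenvalue" cone of `P` is exactly the closed hyperbolicity cone
  of `g` — same size `N`, same variables, no complexity theory;
* `stub_realSpectrumShadow` (the load-bearing stub; the normalised pencil form of the projected
  Lax conjecture WITH size control, cf. the route's two-layer plan "RealSpectrumNormalForm"):
  linear spaces of real matrices with only real eigenvalues have "nonnegative spectrum" cones
  `{x : ∀ τ > 0, det (P x + τ·1) ≠ 0}` that are spectrahedral shadows of size
  `≤ 2^((log₂ N + c)^c)`, `c` absolute;

and the composition is proved here (`hyperbolicVPShadow_of_stubs`, sorry-free; the skeleton theorem
`HyperbolicVPShadow_of : HyperbolicVPShadow` applies it to the two stubs): `VP_ℂ ⇒ dc` quasi-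
polynomial (`isQPBounded_determinantalComplexity_of_isVPFamily_holds`, attained by
`hasDetRepr_determinantalComplexity_holds`), realification of the complex pencil to a real
`2N × 2N` pencil with determinant `f_n · f_n`
(`permanentalCones_hasDetRepr_mul_self_of_complex`, landed with `DetToVP`), the two stubs, and the
composition of the two quasi-polynomial bounds.

Disproof used: none on file for this crux (`ledger crux ls`: no `Disproof.lean`, no Negative
lemmas; `ledger negatives`: nothing on hyperbolicity cones).

STATUS (lead c1, 2026-08-17): stub A LANDED (p143589,
`Theorems/PermanentalConesHyperbolicVPShadowStubLinearRealSpectrumNormalForm.lean`) and is imported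
below — `sorry` remains only in `stub_realSpectrumShadow`. Landed around stub B:
* `Theorems/PermanentalConesHyperbolicVPShadowBridges.lean` (p143750): `HyperbolicDetShadow → stub B`
  and `stub A → (stub B ↔ HyperbolicDetShadow)`;
* `Theorems/PermanentalConesHyperbolicVPShadowNetzerSanyal.lean` (p144610): the crux, crux #3 and
  stub B each imply the Netzer–Sanyal conjecture "every hyperbolicity cone of a real homogeneous
  hyperbolic form is a spectrahedral shadow" (open);
* `Theorems/PermanentalConesHyperbolicVPShadowEquiv.lean` (p145895, using sub-goal V p144875
  `…IsVPFamilyDetAffine.lean`): the converse bridge `HyperbolicVPShadow → HyperbolicDetShadow`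
  (diagonal argument), hence `HyperbolicVPShadow ↔ HyperbolicDetShadow ↔ stub B` are theorems;
* `Theorems/PermanentalConesHyperbolicVPShadowSymmetricCase.lean` (p145916): the symmetric case of
  stub B (cone = the spectrahedron `{x : P x ⪰ 0}`, size `N`);
* `Theorems/PermanentalConesHyperbolicVPShadowExactVars.lean` (p146240): HT restricted to families
  with exactly `n` variables and an eventual size bound still implies the Netzer–Sanyal
  conjecture (padding `f ↦ f·x_{k+1}⋯x_n` and slicing) — no complexity-class repair escapes it.
So the line is closed EXACTLY modulo item `stmt-ValiantsHypothesis-8653`, an open problem containing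
the Netzer–Sanyal conjecture; nothing in it can move independently of 8653.

RESHAPE (lead c2, 2026-08-17): stub B is now DERIVED from the sharper registered stub
`stub_realSpectrumShadow_irreducible` — stub B for pencils that are IRREDUCIBLE (no invariant
subspace `0 ≠ W ≠ ℝ^N` common to all `P x`) and NOT simultaneously symmetrisable (no `S ≻ 0` with
all `S · P x` symmetric) — through the landed reductions
`Theorems/PermanentalConesHyperbolicVPShadowIrreducibleReduction.lean` (p151086: strong induction
on `N` along invariant subspaces, cones of block-triangular pencils intersect and sizes add,
`N·2^((log₂ N + c)^c) ≤ 2^((log₂ N + c + 2)^(c+2))`) and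
`Theorems/PermanentalConesHyperbolicVPShadowBlockCases.lean` (p150485: similarity invariance,
block splitting, symmetrisable pencils have size-`N` spectrahedral cones). The only `sorry` is
`stub_realSpectrumShadow_irreducible`; it is the exact open core of crux #3 (none of its instances
exists for `N ≤ 2`; the first open size is `N = 3`).

RESHAPE (lead c3, 2026-08-17; 21 theorem files landed, all `--supports` this item): stub B′ =
HELTON–VINNIKOV LAYER (dim span{1, range P} ≤ 3 ⇒ size-`N` spectrahedron; stubs T p154238,
S p154100, G p154504, closed modulo the named fact `LewisParriloRamana2005_laxConjecture` = stub L)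
∘ `N ≤ 2` excluded (D₂ p157434) ∘ `N = 3` SETTLED MODULO OSHIME'S 1991 CLASSIFICATIONS (stub O;
certificate catalogue O₁/O₂/O₁ʰ/O₂ʰ/Iʰ/Tʰ/T≤ʰ/D₃ʰ/D₄ʰ/D₅ʰ + bookkeeping Q + assembly N₃ p167200,
size 6) ∘ THE OPEN CORE stub H₄ (`N ≥ 4`). Honesty certificates: E p158141 (the high layer is
inhabited), NS p159239 (high layer + Lax ⇒ Netzer–Sanyal). Infrastructure: S⁺ p157417, R p159259,
Tk p159122. Sorries remain ONLY in stubs L (named fact), O (published classification theorems,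
rendered) and H₄ (open problem). Research record: Cruxes item evidence research/oshime*.md,
research/high-layer-literature.md, research/examples.md, lead-summary.md.
-/

set_option linter.dupNamespace false

namespace Summit.ValiantsHypothesis.ValiantsHypothesis.Cruxes.HyperbolicVPShadow.Birth

open Summit.ValiantsHypothesis.ValiantsHypothesis.Theses.PermanentalCones
open Literature.Computability.AlgebraicComplexity

/-- stub A (linear real-spectrum normal form) — LANDED (p143589,
`Theorems/PermanentalConesHyperbolicVPShadowStubLinearRealSpectrumNormalForm.lean`, wave 1 of lead c1):
an affine real determinantal representation `M` of a homogeneous `g` hyperbolic w.r.t. `e` yields a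
linear pencil `P` of the same size all of whose values have only real eigenvalues and whose closed
"no negative eigenvalue" cone is the closed hyperbolicity cone of `g` (`P x = M(e)⁻¹ · L(x)`).
[difficulty: M — closed] -/
theorem stub_linearRealSpectrumNormalForm :
    ∀ (n N : ℕ) (g : MvPolynomial (Fin n) ℝ) (M : Matrix (Fin N) (Fin N) (MvPolynomial (Fin n) ℝ))
      (e : Fin n → ℝ), IsAffineDetRepr g M → (∃ d : ℕ, g.IsHomogeneous d) →
      (MvPolynomial.eval e g ≠ 0 ∧ ∀ (x : Fin n → ℝ) (z : ℂ),
        MvPolynomial.eval (fun j => (x j : ℂ) + z * (e j : ℂ))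
          (MvPolynomial.map (algebraMap ℝ ℂ) g) = 0 → z.im = 0) →
      ∃ P : (Fin n → ℝ) →ₗ[ℝ] Matrix (Fin N) (Fin N) ℝ,
        (∀ (x : Fin n → ℝ) (z : ℂ),
          ((P x).map (algebraMap ℝ ℂ) - z • (1 : Matrix (Fin N) (Fin N) ℂ)).det = 0 → z.im = 0) ∧
        ∀ x : Fin n → ℝ, (∀ τ : ℝ, 0 < τ → MvPolynomial.eval (x + τ • e) g ≠ 0) ↔
          ∀ τ : ℝ, 0 < τ → (P x + τ • (1 : Matrix (Fin N) (Fin N) ℝ)).det ≠ 0 :=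
  Summit.ValiantsHypothesis.ValiantsHypothesis.Theorems.stub_linearRealSpectrumNormalForm

/-! ### Lead c3 reshape: stub B′ = Helton–Vinnikov layer ∘ high layer

`RS P` below abbreviates (inline, verbatim in every signature) "every `P x` has only real
eigenvalues": `∀ x z, det ((P x).map (algebraMap ℝ ℂ) - z • 1) = 0 → z.im = 0`. -/

/-- stub T — LANDED (p154238, `Theorems/PermanentalConesHyperbolicVPShadowStubTernaryPencilHyperbolicForm.lean`,
wave 1 of lead c3; real-spectrum TERNARY pencils are hyperbolic forms in the
Lewis–Parrilo–Ramana rendering; M, linear algebra): if `b₀, b₁, b₂` are real `N × N` matrices, `Σ eᵢ bᵢ = 1`, and every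
real combination `Σ wᵢ bᵢ` has only real eigenvalues, then `F := det (Σ Xᵢ bᵢ)` is a ternary form
of degree `N` with `F(e) = 1`, every `t ↦ F(w − t e)` has `N` real roots (counted with
multiplicity), and `F(v) = det (Σ vᵢ bᵢ)`. [difficulty: M — `isHomogeneous_det_sum_X_smul`,
`eval_det_sum_X_smul` (LinearPencilForms), `F(w − tE) = (−1)^N · charpoly (Σ wᵢbᵢ)(t)`, and a real
polynomial all of whose complex roots are real has `card roots = natDegree`] -/
theorem stub_ternaryPencil_hyperbolicForm :
    ∀ (N : ℕ) (b : Fin 3 → Matrix (Fin N) (Fin N) ℝ) (e : Fin 3 → ℝ),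
      ∑ i, e i • b i = 1 →
      (∀ (w : Fin 3 → ℝ) (z : ℂ),
        ((∑ i, w i • b i).map (algebraMap ℝ ℂ) - z • (1 : Matrix (Fin N) (Fin N) ℂ)).det = 0 →
          z.im = 0) →
      ∃ F : MvPolynomial (Fin 3) ℝ, F.IsHomogeneous N ∧ MvPolynomial.eval e F = 1 ∧
        (∀ w : Fin 3 → ℝ, Multiset.card (MvPolynomial.aeval
          (fun i => Polynomial.C (w i) - Polynomial.C (e i) * Polynomial.X) F).roots = N) ∧
        ∀ v : Fin 3 → ℝ, MvPolynomial.eval v F = (∑ i, v i • b i).det :=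
  Summit.ValiantsHypothesis.ValiantsHypothesis.Theorems.stub_ternaryPencil_hyperbolicForm

/-- stub L (the Lax conjecture = Helton–Vinnikov theorem, as the EXISTING named fact
`Literature.AlgebraicGeometry.DeterminantalHypersurfaces.LewisParriloRamana2005_laxConjecture`,
verbatim): every ternary hyperbolic form normalised at `e = (1,0,0)` is `det (x·1 + y·B + z·C)`
with `B, C` real symmetric. [difficulty: published theorem (Helton–Vinnikov 2007 Thm 2.2 /
Lewis–Parrilo–Ramana 2005 / Hanselka 2017 Thm 1) — formalisation debt; the tree reduces it to
Hanselka's Theorem 1 (`HeltonVinnikovProofs`, `SpectralRepresentation*`); NOT a worker stub] -/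
theorem stub_laxConjecture :
    Literature.AlgebraicGeometry.DeterminantalHypersurfaces.LewisParriloRamana2005_laxConjecture := by
  sorry

/-- stub S — LANDED (p154100, `Theorems/PermanentalConesHyperbolicVPShadowStubSpectrahedronOfSymmDetIdentity.lean`,
wave 1 of lead c3; a symmetric determinantal identity makes the cone a spectrahedron; S): if
`det (P x + τ·1) = det (L x + τ·1)` for all `x, τ` with `L` a linear pencil of SYMMETRIC matrices,
then the closed nonnegative-spectrum cone of `P` is the spectrahedron `{x : L x ⪰ 0}`, a lifted-LMI
set of size `N` (no lifting variables). [difficulty: S —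
`permanentalCones_forall_det_add_smul_one_ne_zero_iff` (SymmetricCase)] -/
theorem stub_spectrahedron_of_symmDetIdentity :
    ∀ (n N : ℕ) (P L : (Fin n → ℝ) →ₗ[ℝ] Matrix (Fin N) (Fin N) ℝ),
      (∀ x : Fin n → ℝ, (L x).IsSymm) →
      (∀ (x : Fin n → ℝ) (τ : ℝ), (P x + τ • (1 : Matrix (Fin N) (Fin N) ℝ)).det =
        (L x + τ • (1 : Matrix (Fin N) (Fin N) ℝ)).det) →
      Literature.AlgebraicGeometry.HyperbolicPolynomials.IsSpectrahedralShadowOfSize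
        {x : Fin n → ℝ | ∀ τ : ℝ, 0 < τ → (P x + τ • (1 : Matrix (Fin N) (Fin N) ℝ)).det ≠ 0} N :=
  Summit.ValiantsHypothesis.ValiantsHypothesis.Theorems.stub_spectrahedron_of_symmDetIdentity

/-- stub G — LANDED (p154504, `Theorems/PermanentalConesHyperbolicVPShadowStubLowEffGlue.lean`, wave 1 of
lead c3; GLUE of the Helton–Vinnikov layer; M): from stubs T, L, S — taken as
explicit hypotheses, verbatim — every linear pencil `P` of real `N × N` matrices with only real
eigenvalues whose values together with the identity span a space of dimension `≤ 3` (so that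
`det (t·1 + P x)` is a linear pull-back of a TERNARY hyperbolic form) has a closed
nonnegative-spectrum cone that is a genuine spectrahedron of size `N`. Proof: pick a spanning
family `b₀, b₁, b₂` of `V := span (1, range P)` and coordinates `e` of `1`, `c(x)` of `P x`
(linear in `x`); all of `V` has real spectrum (`a·1 + P x`); stub T gives the hyperbolic form
`F = det (Σ Xᵢbᵢ)`, stub L (through `symmetric_pencil_of_laxConjecture`, general direction) gives
symmetric `A₀, A₁, A₂` with `Σ eᵢAᵢ = 1` and `F(v) = det (Σ vᵢAᵢ)`, whence
`det (P x + τ·1) = F(c(x) + τe) = det (Σ cᵢ(x)Aᵢ + τ·1)`, and stub S concludes.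
[difficulty: M — linear algebra in `Submodule.span`, `Module.finBasis`] -/
theorem stub_lowEff_glue :
    (∀ (N : ℕ) (b : Fin 3 → Matrix (Fin N) (Fin N) ℝ) (e : Fin 3 → ℝ),
      ∑ i, e i • b i = 1 →
      (∀ (w : Fin 3 → ℝ) (z : ℂ),
        ((∑ i, w i • b i).map (algebraMap ℝ ℂ) - z • (1 : Matrix (Fin N) (Fin N) ℂ)).det = 0 →
          z.im = 0) →
      ∃ F : MvPolynomial (Fin 3) ℝ, F.IsHomogeneous N ∧ MvPolynomial.eval e F = 1 ∧
        (∀ w : Fin 3 → ℝ, Multiset.card (MvPolynomial.aeval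
          (fun i => Polynomial.C (w i) - Polynomial.C (e i) * Polynomial.X) F).roots = N) ∧
        ∀ v : Fin 3 → ℝ, MvPolynomial.eval v F = (∑ i, v i • b i).det) →
    Literature.AlgebraicGeometry.DeterminantalHypersurfaces.LewisParriloRamana2005_laxConjecture →
    (∀ (n N : ℕ) (P L : (Fin n → ℝ) →ₗ[ℝ] Matrix (Fin N) (Fin N) ℝ),
      (∀ x : Fin n → ℝ, (L x).IsSymm) →
      (∀ (x : Fin n → ℝ) (τ : ℝ), (P x + τ • (1 : Matrix (Fin N) (Fin N) ℝ)).det =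
        (L x + τ • (1 : Matrix (Fin N) (Fin N) ℝ)).det) →
      Literature.AlgebraicGeometry.HyperbolicPolynomials.IsSpectrahedralShadowOfSize
        {x : Fin n → ℝ | ∀ τ : ℝ, 0 < τ → (P x + τ • (1 : Matrix (Fin N) (Fin N) ℝ)).det ≠ 0} N) →
    ∀ (n N : ℕ) (P : (Fin n → ℝ) →ₗ[ℝ] Matrix (Fin N) (Fin N) ℝ),
      (∀ (x : Fin n → ℝ) (z : ℂ),
        ((P x).map (algebraMap ℝ ℂ) - z • (1 : Matrix (Fin N) (Fin N) ℂ)).det = 0 → z.im = 0) →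
      Module.finrank ℝ (Submodule.span ℝ
        (insert (1 : Matrix (Fin N) (Fin N) ℝ) (Set.range P))) ≤ 3 →
      Literature.AlgebraicGeometry.HyperbolicPolynomials.IsSpectrahedralShadowOfSize
        {x : Fin n → ℝ | ∀ τ : ℝ, 0 < τ → (P x + τ • (1 : Matrix (Fin N) (Fin N) ℝ)).det ≠ 0} N :=
  Summit.ValiantsHypothesis.ValiantsHypothesis.Theorems.stub_lowEff_glue

/-- stub D₂ — LANDED (p157434, `Theorems/PermanentalConesHyperbolicVPShadowStubSpanDimLeThreeOfLeTwo.lean`, wave 2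
of lead c3; dimension count for `N ≤ 2`; S/M, linear algebra): a linear pencil of real
`N × N` matrices with `N ≤ 2` all of whose values have only real eigenvalues spans, together with the
identity, a space of dimension `≤ 3` — for `N = 2` the whole of `Mat₂(ℝ)` (dimension 4) contains the
rotation generator `!![0, 1; -1, 0]`, whose translates `a·1 + P x` would have eigenvalues `a ± i`.
Hence the high layer (stub H) is VACUOUS for `N ≤ 2` and H may assume `3 ≤ N`.
[difficulty: S/M — `Module.finrank` of `Matrix (Fin 2) (Fin 2) ℝ` is `4`, `Submodule.eq_top_of_finrank_eq`,
`Matrix.det_fin_two`] -/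
theorem stub_spanDim_le_three_of_le_two :
    ∀ (n N : ℕ) (P : (Fin n → ℝ) →ₗ[ℝ] Matrix (Fin N) (Fin N) ℝ), N ≤ 2 →
      (∀ (x : Fin n → ℝ) (z : ℂ),
        ((P x).map (algebraMap ℝ ℂ) - z • (1 : Matrix (Fin N) (Fin N) ℂ)).det = 0 → z.im = 0) →
      Module.finrank ℝ (Submodule.span ℝ
        (insert (1 : Matrix (Fin N) (Fin N) ℝ) (Set.range P))) ≤ 3 :=
  Summit.ValiantsHypothesis.ValiantsHypothesis.Theorems.stub_spanDim_le_three_of_le_two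

/-! ### Lead c4 reshape of the `N = 3` branch: Hanselka–Kummer layer ∘ Oshime dimension bound

After lead c3 the `N = 3` case of the high layer rested on `stub_oshimeClassification`, a 35-line
RENDERING of Oshime's two 1991 classifications (seven parametrised families). Lead c4 replaces it
by three parameter-free published statements and three worker-sized glue stubs:

* HK — Hanselka–Kummer 2023 (Canad. J. Math., doi:10.4153/S0008414X23000263), **Cor. 12.10**
  (originally Buckley–Košir, Geom. Dedicata 125 (2007), for smooth surfaces; singular ones by Nuij
  density and Plaumann–Vinzant closedness, as printed there): "Every hyperbolic polynomial
  `h ∈ ℝ[x₀,x₁,x₂,x₃]` of degree three has a definite hermitian determinantal representation" — in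
  the normal form of ibid. Prop. 9.1 (`h(1,0,0,0) = 1`, `h = det (x₀·I + x₁A₁ + x₂A₂ + x₃A₃)`,
  `Aᵢ` hermitian `3 × 3`), rendered below exactly like the tree's Lax fact;
* O₅ᵈ — Oshime (I), J. Math. Kyoto Univ. 31 (1991) 937–982, **Thm. 5.1** (= Thm. 7.1): "Suppose
  that a nondegenerate 3×3 matrix family `⟨A₁, …, Aₙ⟩` (`n ≥ 4`) is real-diagonalizable. Then it
  is simultaneously symmetrizable";
* O₅ⁿ — Oshime (II), ibid. 983–1021, **Thm. 6.1 with Lemma 3.2**: "Suppose that a nondegenerate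
  non-diagonalizable 3×3 matrix family `⟨A₁, …, Aₙ⟩` (`n ≥ 4`) has only real eigenvalues. Then it
  is equivalent to a subfamily of (6.1), (6.1'), (6.2) or (6.2')", and (Lemma 3.2) such families
  have a common right eigenvector ((6.1), (6.2)) resp. a common left eigenvector ((6.1'), (6.2'));

so that: `dim span (1, range P) ≥ 5` is impossible for an irreducible, not simultaneously
symmetrisable real-spectrum 3×3 pencil (stub D₄ from O₅ᵈ, O₅ⁿ), and for `dim ≤ 4` the cubic
`F = det (Σ yᵢbᵢ)` of a 4-frame of the span (stub Tₖ, landed) is a hyperbolic quaternary cubic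
form, hence `F = det (y₀A₀ + … + y₃A₃)` with `Aᵢ` hermitian and `Σ eᵢAᵢ = I` (stub HKₑ from HK),
hence `det (P x + τ·1) = det (H x + τ·I)` for a HERMITIAN linear pencil `H`, whose realification
(stub R, landed) and stub S⁺ (landed, `k = 2`) make the cone a spectrahedron of size `6`
(stub G_HK). The seven-family certificate catalogue of lead c3 (O₁…D₅ʰ, N₃ p167200) stays landed
SUPPORT: it exhibits the size-`≤ 6` certificates family by family. -/

/-- stub HK (NAMED FACT, to be vendored by the lead as
`Literature.AlgebraicGeometry.DeterminantalHypersurfaces.HanselkaKummer2023_cor1210`; NOT a worker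
stub): **Hanselka–Kummer 2023, Cor. 12.10** (originally Buckley–Košir 2007) — every hyperbolic
cubic form in four variables has a definite hermitian determinantal representation; rendering in
the normal form of ibid. Prop. 9.1 at `e = (1,0,0,0)`: `p` homogeneous of degree `3`,
`p(1,0,0,0) = 1`, all `t ↦ p(w − t e)` with three real roots ⇒ `p = det (x₀I + x₁A₁ + x₂A₂ + x₃A₃)`
with `A₁, A₂, A₃` hermitian `3 × 3`. [difficulty: published theorem — formalisation debt
(del Pezzo surfaces / Ulrich sheaves); named fact] -/
theorem stub_hanselkaKummer_cor1210 :
    ∀ (p : MvPolynomial (Fin 4) ℝ), p.IsHomogeneous 3 →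
      MvPolynomial.eval ![1, 0, 0, 0] p = 1 →
      (∀ w : Fin 4 → ℝ, Multiset.card (MvPolynomial.aeval
          (fun i => Polynomial.C (w i) - Polynomial.C ((![1, 0, 0, 0] : Fin 4 → ℝ) i) * Polynomial.X)
          p).roots = 3) →
      ∃ A₁ A₂ A₃ : Matrix (Fin 3) (Fin 3) ℂ, A₁.IsHermitian ∧ A₂.IsHermitian ∧ A₃.IsHermitian ∧
        ∀ x : Fin 4 → ℝ, ((MvPolynomial.eval x p : ℝ) : ℂ) =
          ((x 0 : ℂ) • (1 : Matrix (Fin 3) (Fin 3) ℂ) + (x 1 : ℂ) • A₁ + (x 2 : ℂ) • A₂ +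
            (x 3 : ℂ) • A₃).det := by
  sorry

/-- stub HKₑ (general direction; M, worker): from stub HK (taken verbatim as hypothesis) — a
quaternary cubic form `F` with `F(e) = 1` all of whose restrictions `t ↦ F(w − t e)` have three
real roots is `det (Σ vᵢ Aᵢ)` for hermitian `3 × 3` matrices `A₀, …, A₃` with `Σ eᵢ Aᵢ = I`.
Proof: the linear change of variables of `symmetric_pencil_of_laxConjecture`
(`HeltonVinnikovProofs`) with `Fin 3 ↦ Fin 4` and symmetric ↦ hermitian: an invertible `T` with
`T e₀ = e`, `p := F ∘ T`, stub HK for `p`, `Aₖ := Σⱼ (T⁻¹)ⱼₖ Bⱼ` (`B₀ = I`).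
[difficulty: M — `exists_matrix_mulVec_eq`/`eval_aeval_linear` analogues for `Fin 4`] -/
theorem stub_hermitianPencil_of_hanselkaKummer :
    (∀ (p : MvPolynomial (Fin 4) ℝ), p.IsHomogeneous 3 →
      MvPolynomial.eval ![1, 0, 0, 0] p = 1 →
      (∀ w : Fin 4 → ℝ, Multiset.card (MvPolynomial.aeval
          (fun i => Polynomial.C (w i) - Polynomial.C ((![1, 0, 0, 0] : Fin 4 → ℝ) i) * Polynomial.X)
          p).roots = 3) →
      ∃ A₁ A₂ A₃ : Matrix (Fin 3) (Fin 3) ℂ, A₁.IsHermitian ∧ A₂.IsHermitian ∧ A₃.IsHermitian ∧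
        ∀ x : Fin 4 → ℝ, ((MvPolynomial.eval x p : ℝ) : ℂ) =
          ((x 0 : ℂ) • (1 : Matrix (Fin 3) (Fin 3) ℂ) + (x 1 : ℂ) • A₁ + (x 2 : ℂ) • A₂ +
            (x 3 : ℂ) • A₃).det) →
    ∀ (F : MvPolynomial (Fin 4) ℝ) (e : Fin 4 → ℝ), F.IsHomogeneous 3 →
      MvPolynomial.eval e F = 1 →
      (∀ w : Fin 4 → ℝ, Multiset.card (MvPolynomial.aeval
          (fun i => Polynomial.C (w i) - Polynomial.C (e i) * Polynomial.X) F).roots = 3) →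
      ∃ A : Fin 4 → Matrix (Fin 3) (Fin 3) ℂ, (∀ i, (A i).IsHermitian) ∧
        ∑ i, (e i : ℂ) • A i = 1 ∧
        ∀ v : Fin 4 → ℝ, ((MvPolynomial.eval v F : ℝ) : ℂ) = (∑ i, (v i : ℂ) • A i).det := by
  sorry

/-- stub G_HK (GLUE of the Hanselka–Kummer layer; M, worker): from stub Tₖ at `k = 4`, `N = 3`
(real-spectrum 4-frames give hyperbolic quaternary cubic forms), the conclusion of stub HKₑ
(hermitian determinantal representation, general direction), stub R (realification of a hermitian
pencil) and stub S⁺ (a power of `det (P x + τ·1)` that is a symmetric determinant makes the cone a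
spectrahedron) — all taken verbatim as hypotheses — every linear pencil of real `3 × 3` matrices
with only real eigenvalues whose values together with the identity span a space of dimension `≤ 4`
has a closed nonnegative-spectrum cone that is a spectrahedron of size `6`. Proof: verbatim the
landed `stub_lowEff_glue` (frame of `V`, coordinates `e` of `1` and `c(x)` of `P x`, all of `V` has
real spectrum) with the frame size `4`; then `H x := Σ (c x)ᵢ Aᵢ` is a hermitian pencil with
`det (H x + τ I) = det (P x + τ·1)` (as complex numbers), stub R gives a symmetric `6 × 6` pencil `L`
with `det (L x + τ·1) = det (P x + τ·1)²`, and stub S⁺ with `k = 2` concludes.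
[difficulty: M — `permanentalCones_exists_frame_of_finrank_le` (LowEffGlue), `Complex.ofReal_injective`] -/
theorem stub_hkLayer_glue :
    (∀ (b : Fin 4 → Matrix (Fin 3) (Fin 3) ℝ) (e : Fin 4 → ℝ),
      ∑ i, e i • b i = 1 →
      (∀ (w : Fin 4 → ℝ) (z : ℂ),
        ((∑ i, w i • b i).map (algebraMap ℝ ℂ) - z • (1 : Matrix (Fin 3) (Fin 3) ℂ)).det = 0 →
          z.im = 0) →
      ∃ F : MvPolynomial (Fin 4) ℝ, F.IsHomogeneous 3 ∧ MvPolynomial.eval e F = 1 ∧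
        (∀ w : Fin 4 → ℝ, Multiset.card (MvPolynomial.aeval
          (fun i => Polynomial.C (w i) - Polynomial.C (e i) * Polynomial.X) F).roots = 3) ∧
        ∀ v : Fin 4 → ℝ, MvPolynomial.eval v F = (∑ i, v i • b i).det) →
    (∀ (F : MvPolynomial (Fin 4) ℝ) (e : Fin 4 → ℝ), F.IsHomogeneous 3 →
      MvPolynomial.eval e F = 1 →
      (∀ w : Fin 4 → ℝ, Multiset.card (MvPolynomial.aeval
          (fun i => Polynomial.C (w i) - Polynomial.C (e i) * Polynomial.X) F).roots = 3) →
      ∃ A : Fin 4 → Matrix (Fin 3) (Fin 3) ℂ, (∀ i, (A i).IsHermitian) ∧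
        ∑ i, (e i : ℂ) • A i = 1 ∧
        ∀ v : Fin 4 → ℝ, ((MvPolynomial.eval v F : ℝ) : ℂ) = (∑ i, (v i : ℂ) • A i).det) →
    (∀ (n M : ℕ) (H : (Fin n → ℝ) →ₗ[ℝ] Matrix (Fin M) (Fin M) ℂ),
      (∀ x : Fin n → ℝ, (H x).IsHermitian) →
      ∃ L : (Fin n → ℝ) →ₗ[ℝ] Matrix (Fin (2 * M)) (Fin (2 * M)) ℝ,
        (∀ x : Fin n → ℝ, (L x).IsSymm) ∧
        ∀ (x : Fin n → ℝ) (τ : ℝ),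
          (algebraMap ℝ ℂ) ((L x + τ • (1 : Matrix (Fin (2 * M)) (Fin (2 * M)) ℝ)).det) =
            (H x + (τ : ℂ) • (1 : Matrix (Fin M) (Fin M) ℂ)).det *
              star ((H x + (τ : ℂ) • (1 : Matrix (Fin M) (Fin M) ℂ)).det)) →
    (∀ (n N M k : ℕ) (P : (Fin n → ℝ) →ₗ[ℝ] Matrix (Fin N) (Fin N) ℝ)
      (L : (Fin n → ℝ) →ₗ[ℝ] Matrix (Fin M) (Fin M) ℝ), k ≠ 0 →
      (∀ x : Fin n → ℝ, (L x).IsSymm) →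
      (∀ (x : Fin n → ℝ) (τ : ℝ), (L x + τ • (1 : Matrix (Fin M) (Fin M) ℝ)).det =
        ((P x + τ • (1 : Matrix (Fin N) (Fin N) ℝ)).det) ^ k) →
      Literature.AlgebraicGeometry.HyperbolicPolynomials.IsSpectrahedralShadowOfSize
        {x : Fin n → ℝ | ∀ τ : ℝ, 0 < τ → (P x + τ • (1 : Matrix (Fin N) (Fin N) ℝ)).det ≠ 0} M) →
    ∀ (n : ℕ) (P : (Fin n → ℝ) →ₗ[ℝ] Matrix (Fin 3) (Fin 3) ℝ),
      (∀ (x : Fin n → ℝ) (z : ℂ),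
        ((P x).map (algebraMap ℝ ℂ) - z • (1 : Matrix (Fin 3) (Fin 3) ℂ)).det = 0 → z.im = 0) →
      Module.finrank ℝ (Submodule.span ℝ
        (insert (1 : Matrix (Fin 3) (Fin 3) ℝ) (Set.range P))) ≤ 4 →
      Literature.AlgebraicGeometry.HyperbolicPolynomials.IsSpectrahedralShadowOfSize
        {x : Fin n → ℝ | ∀ τ : ℝ, 0 < τ → (P x + τ • (1 : Matrix (Fin 3) (Fin 3) ℝ)).det ≠ 0} 6 := by
  sorry

/-- stub O₅ (NAMED FACTS, to be vendored by the lead as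
`Literature.LinearAlgebra.Matrix.Oshime1991a_thm51` and `…Oshime1991b_thm61`; NOT a worker stub):
the two parameter-free dimension theorems of Oshime's classification of hyperbolic 3×3 systems.
(a) **Oshime (I) 1991, Thm. 5.1**: a nondegenerate (`I, A₁, …, Aₙ` linearly independent),
real-diagonalizable (every real combination `Σ ξᵢAᵢ` is `S·D·S⁻¹`, `S` real invertible, `D` real
diagonal) 3×3 matrix family with `n ≥ 4` is simultaneously symmetrizable (`T⁻¹AᵢT` all symmetric
for one real invertible `T`). (b) **Oshime (II) 1991, Thm. 6.1 with Lemma 3.2**: a nondegenerate,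
NOT real-diagonalizable 3×3 family with `n ≥ 4` all of whose members have only real eigenvalues
has a common right eigenvector or a common left eigenvector (it is equivalent to a subfamily of
the reducible families (6.1), (6.2) resp. their transposes). [difficulty: published theorems
(J. Math. Kyoto Univ. 31 (1991) 937–982, Thm 5.1; 983–1021, Thm 6.1 + Lemma 3.2) — named facts] -/
theorem stub_oshime_dim5_facts :
    (∀ (n : ℕ) (A : Fin n → Matrix (Fin 3) (Fin 3) ℝ), 4 ≤ n →
      LinearIndependent ℝ (Fin.cons (1 : Matrix (Fin 3) (Fin 3) ℝ) A) →
      (∀ ξ : Fin n → ℝ, ∃ S : Matrix (Fin 3) (Fin 3) ℝ, IsUnit S ∧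
        ∃ D : Fin 3 → ℝ, S⁻¹ * (∑ i, ξ i • A i) * S = Matrix.diagonal D) →
      ∃ T : Matrix (Fin 3) (Fin 3) ℝ, IsUnit T ∧ ∀ i, (T⁻¹ * A i * T).IsSymm) ∧
    (∀ (n : ℕ) (A : Fin n → Matrix (Fin 3) (Fin 3) ℝ), 4 ≤ n →
      LinearIndependent ℝ (Fin.cons (1 : Matrix (Fin 3) (Fin 3) ℝ) A) →
      (∀ (ξ : Fin n → ℝ) (z : ℂ),
        ((∑ i, ξ i • A i).map (algebraMap ℝ ℂ) - z • (1 : Matrix (Fin 3) (Fin 3) ℂ)).det = 0 →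
          z.im = 0) →
      (¬ ∀ ξ : Fin n → ℝ, ∃ S : Matrix (Fin 3) (Fin 3) ℝ, IsUnit S ∧
        ∃ D : Fin 3 → ℝ, S⁻¹ * (∑ i, ξ i • A i) * S = Matrix.diagonal D) →
      (∃ v : Fin 3 → ℝ, v ≠ 0 ∧ ∀ i, ∃ μ : ℝ, (A i).mulVec v = μ • v) ∨
      (∃ w : Fin 3 → ℝ, w ≠ 0 ∧ ∀ i, ∃ μ : ℝ, Matrix.vecMul w (A i) = μ • w)) := by
  sorry

/-- stub D₄ (dimension bound; M, worker): from the two Oshime facts (taken verbatim as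
hypotheses) — a linear pencil of real 3×3 matrices with only real eigenvalues that is
IRREDUCIBLE (no common invariant subspace `0 ≠ W ≠ ℝ³`) and NOT simultaneously symmetrisable
(no `S ≻ 0` with all `S·P x` symmetric) spans, together with the identity, a space `V` of dimension
`≤ 4`. Proof: if `dim V ≥ 5`, take a complement `Q` of `ℝ·1` in `V` (`Submodule.exists_isCompl`)
and a basis `A₁, …, Aₙ` of `Q`, `n = dim V − 1 ≥ 4`; `(1, A)` is linearly independent
(`linearIndependent_fin_cons`) and every `Σ ξᵢAᵢ ∈ V` has real spectrum (`a·1 + P x`, cf.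
`permanentalCones_map_smul_one_add_sub`). If the family is real-diagonalizable, fact (a) gives `T`
with all `T⁻¹AᵢT` symmetric, and `S := (T·Tᵀ)⁻¹ ≻ 0` symmetrises every `P x ∈ V = ℝ·1 ⊕ Q` —
contradiction; otherwise fact (b) gives a common right eigenvector `v` (then `W = ℝ·v` is
`P`-invariant, `W ≠ ⊥, ⊤`) or a common left eigenvector `w` (then `W = {u : w ⬝ u = 0}` is
`P`-invariant of dimension `2`) — contradiction. [difficulty: M — `Submodule.exists_isCompl`,
`Module.finBasis`, `linearIndependent_fin_cons`, `Matrix.PosDef` of `(T Tᵀ)⁻¹`, `finrank_span_singleton`] -/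
theorem stub_dimLeFour_of_oshime :
    (∀ (n : ℕ) (A : Fin n → Matrix (Fin 3) (Fin 3) ℝ), 4 ≤ n →
      LinearIndependent ℝ (Fin.cons (1 : Matrix (Fin 3) (Fin 3) ℝ) A) →
      (∀ ξ : Fin n → ℝ, ∃ S : Matrix (Fin 3) (Fin 3) ℝ, IsUnit S ∧
        ∃ D : Fin 3 → ℝ, S⁻¹ * (∑ i, ξ i • A i) * S = Matrix.diagonal D) →
      ∃ T : Matrix (Fin 3) (Fin 3) ℝ, IsUnit T ∧ ∀ i, (T⁻¹ * A i * T).IsSymm) →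
    (∀ (n : ℕ) (A : Fin n → Matrix (Fin 3) (Fin 3) ℝ), 4 ≤ n →
      LinearIndependent ℝ (Fin.cons (1 : Matrix (Fin 3) (Fin 3) ℝ) A) →
      (∀ (ξ : Fin n → ℝ) (z : ℂ),
        ((∑ i, ξ i • A i).map (algebraMap ℝ ℂ) - z • (1 : Matrix (Fin 3) (Fin 3) ℂ)).det = 0 →
          z.im = 0) →
      (¬ ∀ ξ : Fin n → ℝ, ∃ S : Matrix (Fin 3) (Fin 3) ℝ, IsUnit S ∧
        ∃ D : Fin 3 → ℝ, S⁻¹ * (∑ i, ξ i • A i) * S = Matrix.diagonal D) →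
      (∃ v : Fin 3 → ℝ, v ≠ 0 ∧ ∀ i, ∃ μ : ℝ, (A i).mulVec v = μ • v) ∨
      (∃ w : Fin 3 → ℝ, w ≠ 0 ∧ ∀ i, ∃ μ : ℝ, Matrix.vecMul w (A i) = μ • w)) →
    ∀ (n : ℕ) (P : (Fin n → ℝ) →ₗ[ℝ] Matrix (Fin 3) (Fin 3) ℝ),
      (∀ (x : Fin n → ℝ) (z : ℂ),
        ((P x).map (algebraMap ℝ ℂ) - z • (1 : Matrix (Fin 3) (Fin 3) ℂ)).det = 0 → z.im = 0) →
      (∀ W : Submodule ℝ (Fin 3 → ℝ), (∀ (x : Fin n → ℝ), ∀ v ∈ W, Matrix.mulVec (P x) v ∈ W) →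
        W = ⊥ ∨ W = ⊤) →
      (¬ ∃ S : Matrix (Fin 3) (Fin 3) ℝ, S.PosDef ∧ ∀ x : Fin n → ℝ, (S * P x).IsSymm) →
      Module.finrank ℝ (Submodule.span ℝ
        (insert (1 : Matrix (Fin 3) (Fin 3) ℝ) (Set.range P))) ≤ 4 := by
  sorry

/-- stub H₄ (HIGH LAYER of stub B′ for `N ≥ 4`; load-bearing, THE OPEN CORE after lead c3): for an
absolute `c`, every linear pencil of real `N × N` matrices, `N ≥ 4`, with only real eigenvalues
which is IRREDUCIBLE, NOT simultaneously symmetrisable, and whose values together with the identity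
span a space of dimension `≥ 4`, has a closed nonnegative-spectrum cone that is a lifted-LMI set of
size `≤ 2^((log₂ N + c)^c)`. (`N ≤ 2`: vacuous by stub D₂; `N = 3`: the Hanselka–Kummer layer,
size `6`, modulo the named facts HK, O₅.) [difficulty: open-problem — ⊇ the Netzer–Sanyal conjecture
for forms in ≥ 4 variables not pulled back from ternary ones (cf. stub NS); nothing in print
beyond smooth-boundary shadows without size (Netzer–Sanyal 2015 Thm 1.1, Scheiderer 2025 Thm 1.1);
Hanselka–Kummer 2023 §1: already for CUBIC forms in `5 ≤ n + 1 ≤ 42` variables the existence of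
definite determinantal representations of powers is open; KPV 2015 Ex. 33 (Vámos): Wronskians of
hyperbolic forms need not be sums of squares, so no uniform Gram certificate in adjugate entries] -/
theorem stub_realSpectrumShadow_irreducible_highEff_ge4 :
    ∃ c : ℕ, ∀ (n N : ℕ) (P : (Fin n → ℝ) →ₗ[ℝ] Matrix (Fin N) (Fin N) ℝ),
      (∀ (x : Fin n → ℝ) (z : ℂ),
        ((P x).map (algebraMap ℝ ℂ) - z • (1 : Matrix (Fin N) (Fin N) ℂ)).det = 0 → z.im = 0) →
      (∀ W : Submodule ℝ (Fin N → ℝ), (∀ (x : Fin n → ℝ), ∀ v ∈ W, Matrix.mulVec (P x) v ∈ W) →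
        W = ⊥ ∨ W = ⊤) →
      (¬ ∃ S : Matrix (Fin N) (Fin N) ℝ, S.PosDef ∧ ∀ x : Fin n → ℝ, (S * P x).IsSymm) →
      3 < Module.finrank ℝ (Submodule.span ℝ
        (insert (1 : Matrix (Fin N) (Fin N) ℝ) (Set.range P))) →
      4 ≤ N →
      ∃ m ≤ 2 ^ ((Nat.log 2 N + c) ^ c),
        Literature.AlgebraicGeometry.HyperbolicPolynomials.IsSpectrahedralShadowOfSize
          {x : Fin n → ℝ | ∀ τ : ℝ, 0 < τ → (P x + τ • (1 : Matrix (Fin N) (Fin N) ℝ)).det ≠ 0} m := by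
  sorry

/-- The Hanselka–Kummer layer (sorry-free here): stub H at `N = 3` with the absolute size `6`, from
stubs D₄ (with the Oshime facts O₅) and G_HK (with Tₖ landed, HKₑ from HK, R and S⁺ landed). -/
theorem hkLayer_N3 :
    ∀ (n : ℕ) (P : (Fin n → ℝ) →ₗ[ℝ] Matrix (Fin 3) (Fin 3) ℝ),
      (∀ (x : Fin n → ℝ) (z : ℂ),
        ((P x).map (algebraMap ℝ ℂ) - z • (1 : Matrix (Fin 3) (Fin 3) ℂ)).det = 0 → z.im = 0) →
      (∀ W : Submodule ℝ (Fin 3 → ℝ), (∀ (x : Fin n → ℝ), ∀ v ∈ W, Matrix.mulVec (P x) v ∈ W) →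
        W = ⊥ ∨ W = ⊤) →
      (¬ ∃ S : Matrix (Fin 3) (Fin 3) ℝ, S.PosDef ∧ ∀ x : Fin n → ℝ, (S * P x).IsSymm) →
      Literature.AlgebraicGeometry.HyperbolicPolynomials.IsSpectrahedralShadowOfSize
        {x : Fin n → ℝ | ∀ τ : ℝ, 0 < τ → (P x + τ • (1 : Matrix (Fin 3) (Fin 3) ℝ)).det ≠ 0} 6 := by
  intro n P hP hirr hns
  have hdim : Module.finrank ℝ (Submodule.span ℝ
      (insert (1 : Matrix (Fin 3) (Fin 3) ℝ) (Set.range P))) ≤ 4 :=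
    stub_dimLeFour_of_oshime stub_oshime_dim5_facts.1 stub_oshime_dim5_facts.2 n P hP hirr hns
  exact stub_hkLayer_glue
    (fun b e => Summit.ValiantsHypothesis.ValiantsHypothesis.Theorems.stub_framePencil_hyperbolicForm 3 4 b e)
    (stub_hermitianPencil_of_hanselkaKummer stub_hanselkaKummer_cor1210)
    Summit.ValiantsHypothesis.ValiantsHypothesis.Theorems.stub_realify_hermitianPencil
    Summit.ValiantsHypothesis.ValiantsHypothesis.Theorems.stub_spectrahedron_of_symmDetPower
    n P hP hdim

/-- stub H (high layer for `N ≥ 3`) — DERIVED (sorry-free here) from the Hanselka–Kummer layer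
(`hkLayer_N3`, `N = 3`, size `6 ≤ 2^((log₂ 3 + c + 2)^(c+2))`) and stub H₄ (`N ≥ 4`). -/
theorem stub_realSpectrumShadow_irreducible_highEff :
    ∃ c : ℕ, ∀ (n N : ℕ) (P : (Fin n → ℝ) →ₗ[ℝ] Matrix (Fin N) (Fin N) ℝ),
      (∀ (x : Fin n → ℝ) (z : ℂ),
        ((P x).map (algebraMap ℝ ℂ) - z • (1 : Matrix (Fin N) (Fin N) ℂ)).det = 0 → z.im = 0) →
      (∀ W : Submodule ℝ (Fin N → ℝ), (∀ (x : Fin n → ℝ), ∀ v ∈ W, Matrix.mulVec (P x) v ∈ W) →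
        W = ⊥ ∨ W = ⊤) →
      (¬ ∃ S : Matrix (Fin N) (Fin N) ℝ, S.PosDef ∧ ∀ x : Fin n → ℝ, (S * P x).IsSymm) →
      3 < Module.finrank ℝ (Submodule.span ℝ
        (insert (1 : Matrix (Fin N) (Fin N) ℝ) (Set.range P))) →
      3 ≤ N →
      ∃ m ≤ 2 ^ ((Nat.log 2 N + c) ^ c),
        Literature.AlgebraicGeometry.HyperbolicPolynomials.IsSpectrahedralShadowOfSize
          {x : Fin n → ℝ | ∀ τ : ℝ, 0 < τ → (P x + τ • (1 : Matrix (Fin N) (Fin N) ℝ)).det ≠ 0} m := by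
  obtain ⟨c, hc⟩ := stub_realSpectrumShadow_irreducible_highEff_ge4
  refine ⟨c + 2, fun n N P hP hirr hns hdim hN3 => ?_⟩
  rcases hN3.eq_or_lt with h3 | h4
  · -- N = 3: the Hanselka–Kummer layer, size 6
    subst h3
    refine ⟨6, ?_, hkLayer_N3 n P hP hirr hns⟩
    have hb : 2 ≤ Nat.log 2 3 + (c + 2) := by omega
    have h1 : 3 ≤ (Nat.log 2 3 + (c + 2)) ^ (c + 2) :=
      calc 3 ≤ 2 ^ 2 := by norm_num
        _ ≤ (Nat.log 2 3 + (c + 2)) ^ 2 := Nat.pow_le_pow_left hb 2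
        _ ≤ (Nat.log 2 3 + (c + 2)) ^ (c + 2) := Nat.pow_le_pow_right (by omega) (by omega)
    calc 6 ≤ 2 ^ 3 := by norm_num
      _ ≤ 2 ^ ((Nat.log 2 3 + (c + 2)) ^ (c + 2)) := Nat.pow_le_pow_right (by norm_num) h1
  · -- N ≥ 4: the open stub, with the bound relaxed from `c` to `c + 2`
    obtain ⟨m, hm, h⟩ := hc n N P hP hirr hns hdim h4
    refine ⟨m, hm.trans (Nat.pow_le_pow_right (by norm_num) ?_), h⟩
    calc (Nat.log 2 N + c) ^ c ≤ (Nat.log 2 N + (c + 2)) ^ c := Nat.pow_le_pow_left (by omega) c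
      _ ≤ (Nat.log 2 N + (c + 2)) ^ (c + 2) := Nat.pow_le_pow_right (by omega) (by omega)


/-- stub E — LANDED (p158141, `Theorems/PermanentalConesHyperbolicVPShadowStubHighLayerInhabited.lean`, wave 2 of
lead c3; SUPPORT, not in the composition: the high layer is INHABITED at `N = 3`; M, explicit
linear algebra): the integer pencil `P x = x₀·D + x₁·A + x₂·B`, `D = diag(0,1,2)`,
`A = !![0,1,1; 2,0,1; 2,2,2]`, `B = !![0,0,0; -2,0,-1; 4,0,2]` (found by exhaustive search,
research/examples.md E1) satisfies every hypothesis of stub H — real spectrum (certificate: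
`det (t·1 + x₀D + x₁A + x₂B) = det (t·1 + x₀D + x₁S₂ + x₂S₃)` identically, with the SYMMETRIC
`S₂ = !![0,1,2; 1,0,1; 2,1,2]`, `S₃ = diag(0,0,2)`), irreducible (all off-diagonal entries of `A`
non-zero, `D` with distinct eigenvalues), not simultaneously symmetrisable (a symmetriser would be
diagonal and `a₁₂a₂₃a₃₁ = 2 ≠ 4 = a₂₁a₃₂a₁₃`), `dim span{1, D, A, B} = 4` — and nevertheless its cone
is a spectrahedron of size `3` (by the same certificate and stub S). So the c2/c3 reductions do not
make the open core vacuous, and its first inhabitants are settled by symmetric representations of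
the same polynomial rather than of the pencil. [difficulty: M — `Matrix.det_fin_three` + `ring`,
`Matrix.IsHermitian.splits_charpoly`, explicit invariant-subspace chase] -/
theorem stub_highLayer_inhabited :
    ∃ P : (Fin 3 → ℝ) →ₗ[ℝ] Matrix (Fin 3) (Fin 3) ℝ,
      (∀ (x : Fin 3 → ℝ) (z : ℂ),
        ((P x).map (algebraMap ℝ ℂ) - z • (1 : Matrix (Fin 3) (Fin 3) ℂ)).det = 0 → z.im = 0) ∧
      (∀ W : Submodule ℝ (Fin 3 → ℝ), (∀ (x : Fin 3 → ℝ), ∀ v ∈ W, Matrix.mulVec (P x) v ∈ W) →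
        W = ⊥ ∨ W = ⊤) ∧
      (¬ ∃ S : Matrix (Fin 3) (Fin 3) ℝ, S.PosDef ∧ ∀ x : Fin 3 → ℝ, (S * P x).IsSymm) ∧
      3 < Module.finrank ℝ (Submodule.span ℝ
        (insert (1 : Matrix (Fin 3) (Fin 3) ℝ) (Set.range P))) ∧
      Literature.AlgebraicGeometry.HyperbolicPolynomials.IsSpectrahedralShadowOfSize
        {x : Fin 3 → ℝ | ∀ τ : ℝ, 0 < τ → (P x + τ • (1 : Matrix (Fin 3) (Fin 3) ℝ)).det ≠ 0} 3 :=
  Summit.ValiantsHypothesis.ValiantsHypothesis.Theorems.stub_highLayer_inhabited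

/-- stub S⁺ — LANDED (p157417, `Theorems/PermanentalConesHyperbolicVPShadowStubSpectrahedronOfSymmDetPower.lean`,
wave 2 of lead c3; SUPPORT, landing pad for larger symmetric certificates; S): if a POWER of
`det (P x + τ·1)` is the determinant of a linear pencil of SYMMETRIC `M × M` matrices shifted by
`τ·1`, the closed nonnegative-spectrum cone of `P` is the spectrahedron `{x : L x ⪰ 0}` of size `M`.
(With `k = 2`, `M = 2N` this is how a definite HERMITIAN representation of `det (t·1 + P x)` — e.g.
Buckley–Košir's for cubic surfaces, `N = 3`, `M = 6` — enters: realify `X + iY ↦ [[X, −Y], [Y, X]]`.)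
[difficulty: S — `pow_ne_zero_iff`, stub S / `permanentalCones_realSpectrumShadow_symmetric`] -/
theorem stub_spectrahedron_of_symmDetPower :
    ∀ (n N M k : ℕ) (P : (Fin n → ℝ) →ₗ[ℝ] Matrix (Fin N) (Fin N) ℝ)
      (L : (Fin n → ℝ) →ₗ[ℝ] Matrix (Fin M) (Fin M) ℝ), k ≠ 0 →
      (∀ x : Fin n → ℝ, (L x).IsSymm) →
      (∀ (x : Fin n → ℝ) (τ : ℝ), (L x + τ • (1 : Matrix (Fin M) (Fin M) ℝ)).det =
        ((P x + τ • (1 : Matrix (Fin N) (Fin N) ℝ)).det) ^ k) →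
      Literature.AlgebraicGeometry.HyperbolicPolynomials.IsSpectrahedralShadowOfSize
        {x : Fin n → ℝ | ∀ τ : ℝ, 0 < τ → (P x + τ • (1 : Matrix (Fin N) (Fin N) ℝ)).det ≠ 0} M :=
  Summit.ValiantsHypothesis.ValiantsHypothesis.Theorems.stub_spectrahedron_of_symmDetPower

/-- stub Tₖ — LANDED (p159122, `Theorems/PermanentalConesHyperbolicVPShadowStubFramePencilHyperbolicForm.lean`, wave 3 of
lead c3; SUPPORT, infrastructure for the next layers; M): stub T for frames of ANY size `k` —
if `b : Fin k → Mat_N(ℝ)`, `Σ eᵢ bᵢ = 1` and every real combination `Σ wᵢ bᵢ` has only real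
eigenvalues, then `F := det (Σ Xᵢ bᵢ)` is a `k`-ary form of degree `N`, `F(e) = 1`,
`F(v) = det (Σ vᵢ bᵢ)`, and every `t ↦ F(w − t e)` has `N` real roots. (For `k = 4` this feeds the
Buckley–Košir / Hermitian-cubic layer of stub H at `N = 3`; in general it turns a real-spectrum
pencil back into a hyperbolic FORM in the tree's root-counting rendering.)
[difficulty: M — the proof of stub T verbatim with `Fin 3 ↦ Fin k`] -/
theorem stub_framePencil_hyperbolicForm :
    ∀ (N k : ℕ) (b : Fin k → Matrix (Fin N) (Fin N) ℝ) (e : Fin k → ℝ),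
      ∑ i, e i • b i = 1 →
      (∀ (w : Fin k → ℝ) (z : ℂ),
        ((∑ i, w i • b i).map (algebraMap ℝ ℂ) - z • (1 : Matrix (Fin N) (Fin N) ℂ)).det = 0 →
          z.im = 0) →
      ∃ F : MvPolynomial (Fin k) ℝ, F.IsHomogeneous N ∧ MvPolynomial.eval e F = 1 ∧
        (∀ w : Fin k → ℝ, Multiset.card (MvPolynomial.aeval
          (fun i => Polynomial.C (w i) - Polynomial.C (e i) * Polynomial.X) F).roots = N) ∧
        ∀ v : Fin k → ℝ, MvPolynomial.eval v F = (∑ i, v i • b i).det :=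
  Summit.ValiantsHypothesis.ValiantsHypothesis.Theorems.stub_framePencil_hyperbolicForm

/-- stub R — LANDED (p159259, `Theorems/PermanentalConesHyperbolicVPShadowStubRealifyHermitianPencil.lean`, wave 3 of
lead c3; SUPPORT, infrastructure for the next layers; M): REALIFICATION of a Hermitian linear
pencil — for a real-linear pencil `H` of complex Hermitian `M × M` matrices there is a real-linear
pencil `L` of real SYMMETRIC `2M × 2M` matrices (`X + iY ↦ [[X, −Y], [Y, X]]`, reindexed to
`Fin (2M)`) with `det (L x + τ·1) = det (H x + τ·1) · conj (det (H x + τ·1))` for all real `x, τ`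
(the right-hand side is `|det|² = det²`, the determinant of a Hermitian matrix being real). With a
Hermitian determinantal identity `det (H x + τ·1) = det (P x + τ·1)` this is the hypothesis of
stub S⁺ with `k = 2` — the way Buckley–Košir's definite Hermitian representations of cubic
surfaces (N = 3, M = 3, size 6; Kummer 2016 §3) would enter.
[difficulty: M — `permanentalCones_det_fromBlocks_neg_self` (DetToVP), `Matrix.fromBlocks_transpose`] -/
theorem stub_realify_hermitianPencil :
    ∀ (n M : ℕ) (H : (Fin n → ℝ) →ₗ[ℝ] Matrix (Fin M) (Fin M) ℂ),
      (∀ x : Fin n → ℝ, (H x).IsHermitian) →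
      ∃ L : (Fin n → ℝ) →ₗ[ℝ] Matrix (Fin (2 * M)) (Fin (2 * M)) ℝ,
        (∀ x : Fin n → ℝ, (L x).IsSymm) ∧
        ∀ (x : Fin n → ℝ) (τ : ℝ),
          (algebraMap ℝ ℂ) ((L x + τ • (1 : Matrix (Fin (2 * M)) (Fin (2 * M)) ℝ)).det) =
            (H x + (τ : ℂ) • (1 : Matrix (Fin M) (Fin M) ℂ)).det *
              star ((H x + (τ : ℂ) • (1 : Matrix (Fin M) (Fin M) ℂ)).det) :=
  Summit.ValiantsHypothesis.ValiantsHypothesis.Theorems.stub_realify_hermitianPencil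

/-- stub NS — LANDED (p159239, `Theorems/PermanentalConesHyperbolicVPShadowStubHighEffNetzerSanyal.lean`, wave 3 of
lead c3; SUPPORT, the "still open-problem-complete" certificate of the c3 reshape; S/M): the
high layer H together with the Lax conjecture implies the Netzer–Sanyal conjecture "every closed
hyperbolicity cone of a real homogeneous hyperbolic form is a spectrahedral shadow" (open) — so
carving out the Helton–Vinnikov layer has not trivialised the registered open stub. Proof: H and L
give stub B′ (this file's composition, with the landed T, S, G, D₂), B′ gives stub B
(`permanentalCones_realSpectrumShadow_of_irreducible_nonsymmetrizable`, p151086) and B gives (NS)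
(`permanentalCones_netzerSanyal_of_realSpectrumShadow`, p144610).
[difficulty: S/M — composition of landed theorems] -/
theorem stub_highEff_netzerSanyal :
    (∃ c : ℕ, ∀ (n N : ℕ) (P : (Fin n → ℝ) →ₗ[ℝ] Matrix (Fin N) (Fin N) ℝ),
      (∀ (x : Fin n → ℝ) (z : ℂ),
        ((P x).map (algebraMap ℝ ℂ) - z • (1 : Matrix (Fin N) (Fin N) ℂ)).det = 0 → z.im = 0) →
      (∀ W : Submodule ℝ (Fin N → ℝ), (∀ (x : Fin n → ℝ), ∀ v ∈ W, Matrix.mulVec (P x) v ∈ W) →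
        W = ⊥ ∨ W = ⊤) →
      (¬ ∃ S : Matrix (Fin N) (Fin N) ℝ, S.PosDef ∧ ∀ x : Fin n → ℝ, (S * P x).IsSymm) →
      3 < Module.finrank ℝ (Submodule.span ℝ
        (insert (1 : Matrix (Fin N) (Fin N) ℝ) (Set.range P))) →
      3 ≤ N →
      ∃ m ≤ 2 ^ ((Nat.log 2 N + c) ^ c),
        Literature.AlgebraicGeometry.HyperbolicPolynomials.IsSpectrahedralShadowOfSize
          {x : Fin n → ℝ | ∀ τ : ℝ, 0 < τ → (P x + τ • (1 : Matrix (Fin N) (Fin N) ℝ)).det ≠ 0} m) →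
    Literature.AlgebraicGeometry.DeterminantalHypersurfaces.LewisParriloRamana2005_laxConjecture →
    ∀ (k : ℕ) (f : MvPolynomial (Fin k) ℝ) (e : Fin k → ℝ) (d : ℕ), f.IsHomogeneous d →
      Literature.AlgebraicGeometry.HyperbolicPolynomials.IsHyperbolic f e →
      Literature.AlgebraicGeometry.HyperbolicPolynomials.IsSpectrahedralShadow
        (Literature.AlgebraicGeometry.HyperbolicPolynomials.hyperbolicityCone f e) :=
  Summit.ValiantsHypothesis.ValiantsHypothesis.Theorems.stub_highEff_netzerSanyal

/-! ### The classified inhabitants of the high layer at `N = 3` (Oshime 1991) have small spectrahedral cones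

Y. Oshime, J. Math. Kyoto Univ. 31 (1991) 937–982, Thm 4.7 (= Thm 7.2): up to equivalence (basis change of
the span, adding multiples of `1`, simultaneous real similarity) the nondegenerate uniformly
real-diagonalisable 3×3 families `⟨A, B, C⟩` that are NOT simultaneously symmetrisable are exactly
family (1) `⟨diag(1,0,0), E₁₂+E₂₁, [[0,a,1],[-a,0,0],[1,0,0]]⟩`, `0 < a < 1`, and family (2)
`⟨diag(1,0,0), [[0,α,0],[α,1,0],[0,0,-1]], [[0,β,γ],[β',0,1],[γ',1,0]]⟩` with
`D := 2αγ − α² − β² > 0`, `D' := 2αγ' − α² − β'² > 0`, `(β,γ) ≠ (β',γ')`; and (Thm 5.1) for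
`dim ≥ 5` every real-diagonalisable family is symmetrisable. Lead c3 found (research/oshime.md):
family (1) has the REAL SYMMETRIC certificate `det (t·1 + x diag(1,0,0) + y(E₁₂+E₂₁) + zC_a)
= det [[t,0,y],[0,t,cz],[y,cz,t+x]]`, `c = √(1−a²)`; family (2) has NO real symmetric 3×3
certificate but the HERMITIAN one `S₃ = [[0, s/2 + i m, p + i q],[s/2 − i m, 0, 1],[p − i q, 1, 0]]`,
`s = β+β'`, `m = (√D+√D')/2`, `δ = (β−β')/2`, `σ = (γ+γ')/2`, `ρ = (γ−γ')/2`, `u = (m²+δ²)/α`,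
`p = σ − u`, `q = (su/2 − ρδ)/m`: `det (t·1 + xA + yB + zS₃) = det (t·1 + xA + yB + zC)`. -/

/-- stub O₁ — LANDED (p162466, `Theorems/PermanentalConesHyperbolicVPShadowStubOshimeFamily1Spectrahedron.lean`, wave 4
of lead c3; SUPPORT; S/M): every member of Oshime's family (1) — for all real `a` with `a² ≤ 1` —
has a closed nonnegative-spectrum cone that is a spectrahedron of size `3`, by the real symmetric
certificate `L(x) = x₀E₃₃ + x₁(E₁₃+E₃₁) + √(1−a²)·x₂(E₂₃+E₃₂)` and stub S.
[difficulty: S/M — `Matrix.det_fin_three`, `Real.sq_sqrt`, `stub_spectrahedron_of_symmDetIdentity`] -/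
theorem stub_oshimeFamily1_spectrahedron :
    ∀ a : ℝ, a ^ 2 ≤ 1 →
      Literature.AlgebraicGeometry.HyperbolicPolynomials.IsSpectrahedralShadowOfSize
        {x : Fin 3 → ℝ | ∀ τ : ℝ, 0 < τ →
          (x 0 • !![(1 : ℝ), 0, 0; 0, 0, 0; 0, 0, 0] + x 1 • !![(0 : ℝ), 1, 0; 1, 0, 0; 0, 0, 0] +
            x 2 • !![(0 : ℝ), a, 1; -a, 0, 0; 1, 0, 0] + τ • (1 : Matrix (Fin 3) (Fin 3) ℝ)).det ≠ 0} 3 :=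
  Summit.ValiantsHypothesis.ValiantsHypothesis.Theorems.stub_oshimeFamily1_spectrahedron

/-- stub O₂ — LANDED (p162839, `Theorems/PermanentalConesHyperbolicVPShadowStubOshimeFamily2Spectrahedron.lean`, wave 4
of lead c3; SUPPORT; M/L): every member of Oshime's family (2) — all real `α, β, β', γ, γ'` with
`α > 0`, `2αγ − α² − β² > 0`, `2αγ' − α² − β'² > 0` — has a closed nonnegative-spectrum cone that is
a spectrahedron of size `6`: the Hermitian certificate `S₃` above gives
`det (t·1 + xA + yB + zS₃) = det (t·1 + xA + yB + zC)` over `ℂ` (the real part of the left side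
involves `m, q` only through `m², mq, q²`, and the relations `m² = αu − δ²`, `mq = su/2 − ρδ`,
`q² = u(2σ − α − u) − ρ²` — which hold for `u = ((√D+√D')²/4 + δ²)/α` — turn it into the right
side for every `u`), then stub R (realification, size `2·3`) and stub S⁺ (`k = 2`) conclude.
Together with O₁, E and Oshime's classification this settles, on paper, the uniformly
real-diagonalisable part of the high layer at `N = 3` with `m ≤ 6`.
[difficulty: M/L — real algebra with `Real.sqrt`, a complex `Matrix.det_fin_three` identity by
`linear_combination`, `stub_realify_hermitianPencil`, `stub_spectrahedron_of_symmDetPower`] -/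
theorem stub_oshimeFamily2_spectrahedron :
    ∀ α β β' γ γ' : ℝ, 0 < α → 0 < 2 * α * γ - α ^ 2 - β ^ 2 → 0 < 2 * α * γ' - α ^ 2 - β' ^ 2 →
      Literature.AlgebraicGeometry.HyperbolicPolynomials.IsSpectrahedralShadowOfSize
        {x : Fin 3 → ℝ | ∀ τ : ℝ, 0 < τ →
          (x 0 • !![(1 : ℝ), 0, 0; 0, 0, 0; 0, 0, 0] + x 1 • !![0, α, 0; α, 1, 0; 0, 0, -1] +
            x 2 • !![0, β, γ; β', 0, 1; γ', 1, 0] + τ • (1 : Matrix (Fin 3) (Fin 3) ℝ)).det ≠ 0} 6 :=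
  Summit.ValiantsHypothesis.ValiantsHypothesis.Theorems.stub_oshimeFamily2_spectrahedron

/-! ### Certificate catalogue for `N = 3`, homogenised pencils `x₀·1 + x₁A + x₂B + x₃C` (lead c3, wave 5)

By Oshime's two 1991 classifications (J. Math. Kyoto Univ. 31: (I) Thm 4.7, Thm 5.1; (II) Thms 6.1–6.3)
the irreducible, not simultaneously symmetrisable real 3×3 families with only real eigenvalues and
`dim span{1,A,B,C} = 4` are, up to equivalence (basis change of the span, adding multiples of `1`,
real similarity, transposition), the families (1), (2), (I) of paper (I) and (T), (D3), (D4), (D5)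
of paper (II); there are none of dimension `≥ 5`. Lead c3 found explicit determinantal certificates
for ALL of them (research/oshime.md, research/oshime2.md): every such cone is a spectrahedron of size
`≤ 4` on paper. The stubs below record Lean versions (sizes 3 or 6, through stubs S / R / S⁺) for
the HOMOGENISED pencils, from which every equivalent pencil's cone is a linear preimage. -/

/-- stub O₁ʰ (SUPPORT; S) — LANDED (p165111, wave 5 of lead c3): family (1) of Oshime (I) Thm 4.7, homogenised — size `3` (real symmetric
certificate `x₀·1 + x₁E₃₃ + x₂(E₁₃+E₃₁) + √(1−a²)x₃(E₂₃+E₃₂)`). [difficulty: S — reuse the landed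
identity of `stub_oshimeFamily1_spectrahedron`] -/
theorem stub_oshimeFamily1h_spectrahedron :
    ∀ a : ℝ, a ^ 2 ≤ 1 →
      Literature.AlgebraicGeometry.HyperbolicPolynomials.IsSpectrahedralShadowOfSize
        {x : Fin 4 → ℝ | ∀ τ : ℝ, 0 < τ →
          (x 0 • (1 : Matrix (Fin 3) (Fin 3) ℝ) + x 1 • !![(1 : ℝ), 0, 0; 0, 0, 0; 0, 0, 0] +
            x 2 • !![(0 : ℝ), 1, 0; 1, 0, 0; 0, 0, 0] +
            x 3 • !![(0 : ℝ), a, 1; -a, 0, 0; 1, 0, 0] +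
            τ • (1 : Matrix (Fin 3) (Fin 3) ℝ)).det ≠ 0} 3 :=
  Summit.ValiantsHypothesis.ValiantsHypothesis.Theorems.stub_oshimeFamily1h_spectrahedron

/-- stub O₂ʰ (SUPPORT; S/M) — LANDED (p165091, wave 5 of lead c3): family (2) of Oshime (I) Thm 4.7, homogenised — size `6` (Hermitian
certificate of `stub_oshimeFamily2_spectrahedron`, realification R, stub S⁺ with `k = 2`).
[difficulty: S/M — reuse `permanentalCones_oshime2_certificate` / `permanentalCones_oshime2_detIdentity`] -/
theorem stub_oshimeFamily2h_spectrahedron :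
    ∀ α β β' γ γ' : ℝ, 0 < α → 0 < 2 * α * γ - α ^ 2 - β ^ 2 → 0 < 2 * α * γ' - α ^ 2 - β' ^ 2 →
      Literature.AlgebraicGeometry.HyperbolicPolynomials.IsSpectrahedralShadowOfSize
        {x : Fin 4 → ℝ | ∀ τ : ℝ, 0 < τ →
          (x 0 • (1 : Matrix (Fin 3) (Fin 3) ℝ) + x 1 • !![(1 : ℝ), 0, 0; 0, 0, 0; 0, 0, 0] +
            x 2 • !![0, α, 0; α, 1, 0; 0, 0, -1] +
            x 3 • !![0, β, γ; β', 0, 1; γ', 1, 0] +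
            τ • (1 : Matrix (Fin 3) (Fin 3) ℝ)).det ≠ 0} 6 :=
  Summit.ValiantsHypothesis.ValiantsHypothesis.Theorems.stub_oshimeFamily2h_spectrahedron

/-- stub Iʰ (SUPPORT; M) — LANDED (p165225, wave 5 of lead c3): family (I) of Oshime (I) Prop 4.6 / Thm 7.3(2) (the non-uniformly
diagonalisable extension of Petrovsky's pair), homogenised: `A = diag(1,0,0)`, `B = E₁₂+E₂₁+E₂₃`,
`C = [[0, β, −γ], [β(1−a), 1, 0], [−2a, 0, −1]]`, hyperbolic iff `0 < a < 1`, `γ > β²/8` (closure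
taken here) — size `6` via the Hermitian certificate
`H = [[t+x, u₁(y+βz), u₂(y+(β/2−im)z)], [u₁(y+βz), t+z, 0], [u₂(y+(β/2+im)z), 0, t−z]]`,
`u₁² = 1−a`, `u₂² = a`, `m² = 2γ − β²/4`: `det H = det (t·1 + xA + yB + zC)`.
[difficulty: M — as `stub_oshimeFamily2_spectrahedron`] -/
theorem stub_oshimeFamilyIh_spectrahedron :
    ∀ a β γ : ℝ, 0 ≤ a → a ≤ 1 → β ^ 2 ≤ 8 * γ →
      Literature.AlgebraicGeometry.HyperbolicPolynomials.IsSpectrahedralShadowOfSize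
        {x : Fin 4 → ℝ | ∀ τ : ℝ, 0 < τ →
          (x 0 • (1 : Matrix (Fin 3) (Fin 3) ℝ) + x 1 • !![(1 : ℝ), 0, 0; 0, 0, 0; 0, 0, 0] +
            x 2 • !![(0 : ℝ), 1, 0; 1, 0, 1; 0, 0, 0] +
            x 3 • !![0, β, -γ; β * (1 - a), 1, 0; -2 * a, 0, -1] +
            τ • (1 : Matrix (Fin 3) (Fin 3) ℝ)).det ≠ 0} 6 :=
  Summit.ValiantsHypothesis.ValiantsHypothesis.Theorems.stub_oshimeFamilyIh_spectrahedron

/-- stub Tʰ (SUPPORT; M) — LANDED (p165175, wave 5 of lead c3): family (T) of Oshime (II) Prop 4.6 / Thm 6.2 (the Jordan-block family),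
homogenised: `A = J₃ = E₁₂+E₂₃`, `B = [[0, e₂, −e₃], [−1, e₁, 0], [0, 1, 0]]` (`eₖ` the elementary
symmetric functions of `s₁, s₂, s₃`), `C = b₀[[0, b₁+b₂, −b₁b₂], [0, 1, 0], [0, 0, 0]]`, hyperbolic
iff `s₁ ≤ b₁ ≤ s₂ ≤ b₂ ≤ s₃` (here with `s₁ < s₂ < s₃`) — size `3`: `det (t·1 + xJ₃ + yB + zC)` does
not involve `x` and equals `det (t·1 + y·diag(s) + z·b₀ccᵀ)` with `cᵢ² = (b₁−sᵢ)(b₂−sᵢ)/Πⱼ≠ᵢ(sⱼ−sᵢ) ≥ 0`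
(matrix determinant lemma + Lagrange interpolation), a REAL SYMMETRIC certificate although the
family is irreducible and not symmetrisable. [difficulty: M — `Matrix.det_fin_three`, three
`Real.sqrt`s, `stub_spectrahedron_of_symmDetIdentity` with `n = 4`] -/
theorem stub_oshimeFamilyTh_spectrahedron :
    ∀ s₁ s₂ s₃ b₀ b₁ b₂ : ℝ, s₁ < s₂ → s₂ < s₃ → s₁ ≤ b₁ → b₁ ≤ s₂ → s₂ ≤ b₂ → b₂ ≤ s₃ →
      Literature.AlgebraicGeometry.HyperbolicPolynomials.IsSpectrahedralShadowOfSize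
        {x : Fin 4 → ℝ | ∀ τ : ℝ, 0 < τ →
          (x 0 • (1 : Matrix (Fin 3) (Fin 3) ℝ) + x 1 • !![(0 : ℝ), 1, 0; 0, 0, 1; 0, 0, 0] +
            x 2 • !![0, s₁ * s₂ + s₂ * s₃ + s₃ * s₁, -(s₁ * s₂ * s₃); -1, s₁ + s₂ + s₃, 0; 0, 1, 0] +
            x 3 • !![0, b₀ * (b₁ + b₂), -(b₀ * b₁ * b₂); 0, b₀, 0; 0, 0, 0] +
            τ • (1 : Matrix (Fin 3) (Fin 3) ℝ)).det ≠ 0} 3 :=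
  Summit.ValiantsHypothesis.ValiantsHypothesis.Theorems.stub_oshimeFamilyTh_spectrahedron

/-- stub D₃ʰ (SUPPORT; M) — LANDED (p165173, wave 5 of lead c3): family (D3) of Oshime (II) Prop 5.12 / Thm 6.3(3), homogenised:
`A = E₁₁+E₂₃`, `B = [[2a−1, 1, −a], [a, 0, 0], [−1, 0, 0]]`, `C = [[2δ, 1, γ−δ], [γ+δ, 1, 0], [1, 0, −1]]`,
hyperbolic iff `2a−1 ≥ 0`, `1+2γ ≥ 0`, `δ² ≤ (2a−1)(1+2γ)` — size `6` via the Hermitian certificate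
`H = [[x+t+(2a−1)y+2δz, v̄, 0], [v, t+y, 0], [0, 0, t−y]]`, `v = √(2a−1)·y + (p − iq)·z`,
`p√(2a−1) = δ`, `p² + q² = 1+2γ` (so `|v|² = (2a−1)y² + 2δyz + (1+2γ)z²`):
`det H = (t−y)·[(x+t+(2a−1)y+2δz)(t+y) − |v|²] = det (t·1 + xA + yB + zC)`.
[difficulty: M — as `stub_oshimeFamily2_spectrahedron`; case `2a − 1 = 0` (then `δ = 0`) separately] -/
theorem stub_oshimeFamilyD3h_spectrahedron :
    ∀ a γ δ : ℝ, 1 ≤ 2 * a → 0 ≤ 1 + 2 * γ → δ ^ 2 ≤ (2 * a - 1) * (1 + 2 * γ) →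
      Literature.AlgebraicGeometry.HyperbolicPolynomials.IsSpectrahedralShadowOfSize
        {x : Fin 4 → ℝ | ∀ τ : ℝ, 0 < τ →
          (x 0 • (1 : Matrix (Fin 3) (Fin 3) ℝ) + x 1 • !![(1 : ℝ), 0, 0; 0, 0, 1; 0, 0, 0] +
            x 2 • !![2 * a - 1, 1, -a; a, 0, 0; -1, 0, 0] +
            x 3 • !![2 * δ, 1, γ - δ; γ + δ, 1, 0; 1, 0, -1] +
            τ • (1 : Matrix (Fin 3) (Fin 3) ℝ)).det ≠ 0} 6 :=
  Summit.ValiantsHypothesis.ValiantsHypothesis.Theorems.stub_oshimeFamilyD3h_spectrahedron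

/-- stub D₄ʰ (SUPPORT; M) — LANDED (p165353, wave 5 of lead c3): family (D4) of Oshime (II) Prop 5.13 / Thm 6.3(4), homogenised:
`A = E₁₁+E₂₃`, `B = [[ρ, 1, −a], [a, 0, 0], [−1, 0, 0]]`, `C = diag(σ, 1, −1)`, hyperbolic iff
`2a−1 ≥ 0` and `ρ² + σ² ≤ (2a−1)²` — size `6` via the Hermitian certificate
`H = [[x+t+ρy+σz, u₁y, (c−id)y], [u₁y, t+y, z], [(c+id)y, z, t−y]]`, `u₁² = (2a−1+ρ)/2`,
`c² + d² = (2a−1−ρ)/2`, `2u₁c = σ`: `det H = det (t·1 + xA + yB + zC)`.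
[difficulty: M — as `stub_oshimeFamily2_spectrahedron`; case `2a−1+ρ = 0` (then `σ = 0`) separately] -/
theorem stub_oshimeFamilyD4h_spectrahedron :
    ∀ a ρ σ : ℝ, 1 ≤ 2 * a → ρ ^ 2 + σ ^ 2 ≤ (2 * a - 1) ^ 2 →
      Literature.AlgebraicGeometry.HyperbolicPolynomials.IsSpectrahedralShadowOfSize
        {x : Fin 4 → ℝ | ∀ τ : ℝ, 0 < τ →
          (x 0 • (1 : Matrix (Fin 3) (Fin 3) ℝ) + x 1 • !![(1 : ℝ), 0, 0; 0, 0, 1; 0, 0, 0] +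
            x 2 • !![ρ, 1, -a; a, 0, 0; -1, 0, 0] +
            x 3 • !![σ, 0, 0; 0, 1, 0; 0, 0, -1] +
            τ • (1 : Matrix (Fin 3) (Fin 3) ℝ)).det ≠ 0} 6 :=
  Summit.ValiantsHypothesis.ValiantsHypothesis.Theorems.stub_oshimeFamilyD4h_spectrahedron

/-- stub D₅ʰ (SUPPORT; L) — LANDED (p165906, wave 5 of lead c3): family (D5) of Oshime (II) Prop 5.19 / Thm 6.3(5), homogenised:
`A = E₁₁+E₂₃`, `B = [[ρ, 1, −a], [a, 0, 0], [−1, 0, 0]]`, `C = [[σ, b, γ−δ], [γ+δ, 1, 0], [b, 0, −1]]`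
with `0 < b < 1`, `ρ = (1 − 1/b²)γ + ab + (a−1)/b`, `σ = (b + 1/b)δ`, hyperbolic iff `ab + γ ≥ 0` and
`(γ + (1−a)b)² + b²δ² ≤ b²(ab+γ)²` (conditions re-derived in research/oshime2.md §2.4) — size `6` via
the Hermitian certificate of research/oshime2.md §2.4(b) (`κ = √(1−b²)`,
`H = [[x+t+ρy+σz, v̄₁, v̄₂], [v₁, t+y, κz], [v₂, κz, t−y]]`,
`2b(1−b)v₁ = κ[α₁(y+bz) − α₂(y−bz)]`, `2b(1−b)v₂ = (1−b)[α₁(y+bz) + α₂(y−bz)]`, `α₁ = A ≥ 0`,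
`α₂ = Be^{−iψ}`, `A² = b(1−b)(ab+γ+δ)`, `B² = b(1−b)(ab+γ−δ)`, `AB cos ψ = (1−b)(γ+(1−a)b)`).
[difficulty: L — the largest certificate; same pipeline as `stub_oshimeFamily2_spectrahedron`] -/
theorem stub_oshimeFamilyD5h_spectrahedron :
    ∀ a b γ δ : ℝ, 0 < b → b < 1 → 0 ≤ a * b + γ →
      (γ + (1 - a) * b) ^ 2 + b ^ 2 * δ ^ 2 ≤ b ^ 2 * (a * b + γ) ^ 2 →
      Literature.AlgebraicGeometry.HyperbolicPolynomials.IsSpectrahedralShadowOfSize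
        {x : Fin 4 → ℝ | ∀ τ : ℝ, 0 < τ →
          (x 0 • (1 : Matrix (Fin 3) (Fin 3) ℝ) + x 1 • !![(1 : ℝ), 0, 0; 0, 0, 1; 0, 0, 0] +
            x 2 • !![(1 - 1 / b ^ 2) * γ + a * b + (a - 1) / b, 1, -a; a, 0, 0; -1, 0, 0] +
            x 3 • !![(b + 1 / b) * δ, b, γ - δ; γ + δ, 1, 0; b, 0, -1] +
            τ • (1 : Matrix (Fin 3) (Fin 3) ℝ)).det ≠ 0} 6 :=
  Summit.ValiantsHypothesis.ValiantsHypothesis.Theorems.stub_oshimeFamilyD5h_spectrahedron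

/-! ### Towards the N = 3 assembly modulo Oshime's classifications (lead c3, wave 6) -/

/-- stub Q — LANDED (p166417, wave 6 of lead c3; SUPPORT, bookkeeping; S/M): cones are invariant under Oshime-equivalence up to a linear
preimage — if `P x = T·G(Mx)·T⁻¹` (or `T·G(Mx)ᵀ·T⁻¹`) for an invertible `T` and a linear `M`, a
size-`m` lifted-LMI description of the cone of `G` pulls back to a size-`m'` (`m' ≥ m`) description
of the cone of `P` (`det (P x + τ·1) = det (G(Mx) + τ·1)`; linear preimage; padding by an identity
block). [difficulty: S/M — `Matrix.det_conj`-type computation, `permanentalCones_isSpectrahedralShadowOfSize_of_rep`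
(BlockCases), `posSemidef_fromBlocks_zero_iff` (SpectrahedralShadowCalculus)] -/
theorem stub_cone_of_conjPreimage :
    ∀ (n n' N m m' : ℕ) (P : (Fin n → ℝ) →ₗ[ℝ] Matrix (Fin N) (Fin N) ℝ)
      (G : (Fin n' → ℝ) →ₗ[ℝ] Matrix (Fin N) (Fin N) ℝ) (M : (Fin n → ℝ) →ₗ[ℝ] (Fin n' → ℝ))
      (T : Matrix (Fin N) (Fin N) ℝ), IsUnit T →
      ((∀ x, P x = T * G (M x) * T⁻¹) ∨ (∀ x, P x = T * (G (M x)).transpose * T⁻¹)) → m ≤ m' →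
      Literature.AlgebraicGeometry.HyperbolicPolynomials.IsSpectrahedralShadowOfSize
        {y : Fin n' → ℝ | ∀ τ : ℝ, 0 < τ → (G y + τ • (1 : Matrix (Fin N) (Fin N) ℝ)).det ≠ 0} m →
      Literature.AlgebraicGeometry.HyperbolicPolynomials.IsSpectrahedralShadowOfSize
        {x : Fin n → ℝ | ∀ τ : ℝ, 0 < τ → (P x + τ • (1 : Matrix (Fin N) (Fin N) ℝ)).det ≠ 0} m' :=
  Summit.ValiantsHypothesis.ValiantsHypothesis.Theorems.stub_cone_of_conjPreimage

/-- stub T≤ʰ — LANDED (p166407, wave 6 of lead c3; SUPPORT; M): family (T) with COINCIDENT roots allowed (`s₁ ≤ s₂ ≤ s₃`, as printed by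
Oshime (II) Prop 4.6): still a size-`3` spectrahedral cone — the certificate `t·1 + y·diag(s) + z·b₀ccᵀ`
exists in the degenerate cases too (`s₁ = s₂ < s₃`: `b₁ = s₁`, `c₁² + c₂² = (b₂−s₁)/(s₃−s₁)`,
`c₃² = (s₃−b₂)/(s₃−s₁)`; `s₁ < s₂ = s₃` symmetrically; all equal: `Σcᵢ² = 1`).
[difficulty: M — case analysis on the coincidences, reuse the lemmas of `stub_oshimeFamilyTh_spectrahedron`] -/
theorem stub_oshimeFamilyTle_spectrahedron :
    ∀ s₁ s₂ s₃ b₀ b₁ b₂ : ℝ, s₁ ≤ s₂ → s₂ ≤ s₃ → s₁ ≤ b₁ → b₁ ≤ s₂ → s₂ ≤ b₂ → b₂ ≤ s₃ →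
      Literature.AlgebraicGeometry.HyperbolicPolynomials.IsSpectrahedralShadowOfSize
        {x : Fin 4 → ℝ | ∀ τ : ℝ, 0 < τ →
          (x 0 • (1 : Matrix (Fin 3) (Fin 3) ℝ) + x 1 • !![(0 : ℝ), 1, 0; 0, 0, 1; 0, 0, 0] +
            x 2 • !![0, s₁ * s₂ + s₂ * s₃ + s₃ * s₁, -(s₁ * s₂ * s₃); -1, s₁ + s₂ + s₃, 0; 0, 1, 0] +
            x 3 • !![0, b₀ * (b₁ + b₂), -(b₀ * b₁ * b₂); 0, b₀, 0; 0, 0, 0] +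
            τ • (1 : Matrix (Fin 3) (Fin 3) ℝ)).det ≠ 0} 3 :=
  Summit.ValiantsHypothesis.ValiantsHypothesis.Theorems.stub_oshimeFamilyTle_spectrahedron

/-- stub N₃ — LANDED (p167200, wave 7 of lead c3; the N = 3 ASSEMBLY modulo Oshime's classifications; M, bookkeeping): IF every
linear pencil of real 3×3 matrices with only real eigenvalues that is irreducible, not simultaneously
symmetrisable and spans (with `1`) a space of dimension `≥ 4` is Oshime-equivalent
(`P x = T·G(Mx)·T⁻¹` or `T·G(Mx)ᵀ·T⁻¹`, `T` invertible, `M` linear) to a member `G` of one of the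
seven homogenised canonical families (1), (2), (I) [Oshime (I), J. Math. Kyoto Univ. 31 (1991)
937–982, Thm 4.7 with Prop 4.6, and Thm 5.1 for dimension ≥ 5], (T), (D3), (D4), (D5)
[Oshime (II), ibid. 983–1021, Thms 6.1–6.3] — the hypothesis below is the lead's RENDERING of
these printed classification theorems (parameter regions as closures / as re-derived in
research/oshime2.md; transposes allowed throughout; dimension ≥ 5 is vacuous by O-I Thm 5.1 and
O-II Thm 6.1), to be vendored as Literature facts by the planners — THEN stub H holds at `N = 3`
with the absolute size `6`: the cone of every such pencil is a lifted-LMI set of size `6`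
(certificates O₁ʰ, O₂ʰ, Iʰ, T≤ʰ, D₃ʰ, D₄ʰ, D₅ʰ and the bookkeeping stub Q).
[difficulty: M — case analysis over the seven families; everything it uses is landed] -/
theorem stub_highEff_N3_of_oshimeClassification :
    (∀ (n : ℕ) (P : (Fin n → ℝ) →ₗ[ℝ] Matrix (Fin 3) (Fin 3) ℝ),
      (∀ (x : Fin n → ℝ) (z : ℂ),
        ((P x).map (algebraMap ℝ ℂ) - z • (1 : Matrix (Fin 3) (Fin 3) ℂ)).det = 0 → z.im = 0) →
      (∀ W : Submodule ℝ (Fin 3 → ℝ), (∀ (x : Fin n → ℝ), ∀ v ∈ W, Matrix.mulVec (P x) v ∈ W) →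
        W = ⊥ ∨ W = ⊤) →
      (¬ ∃ S : Matrix (Fin 3) (Fin 3) ℝ, S.PosDef ∧ ∀ x : Fin n → ℝ, (S * P x).IsSymm) →
      3 < Module.finrank ℝ (Submodule.span ℝ
        (insert (1 : Matrix (Fin 3) (Fin 3) ℝ) (Set.range P))) →
      ∃ (T : Matrix (Fin 3) (Fin 3) ℝ) (M : (Fin n → ℝ) →ₗ[ℝ] (Fin 4 → ℝ))
        (G : (Fin 4 → ℝ) →ₗ[ℝ] Matrix (Fin 3) (Fin 3) ℝ), IsUnit T ∧
        ((∀ x, P x = T * G (M x) * T⁻¹) ∨ (∀ x, P x = T * (G (M x)).transpose * T⁻¹)) ∧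
        ((∃ a : ℝ, a ^ 2 ≤ 1 ∧
            ∀ y : Fin 4 → ℝ, G y = y 0 • (1 : Matrix (Fin 3) (Fin 3) ℝ) + y 1 • !![(1 : ℝ), 0, 0; 0, 0, 0; 0, 0, 0] +
              y 2 • !![(0 : ℝ), 1, 0; 1, 0, 0; 0, 0, 0] + y 3 • !![(0 : ℝ), a, 1; -a, 0, 0; 1, 0, 0]) ∨
          (∃ α β β' γ γ' : ℝ, 0 < α ∧ 0 < 2 * α * γ - α ^ 2 - β ^ 2 ∧ 0 < 2 * α * γ' - α ^ 2 - β' ^ 2 ∧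
            ∀ y : Fin 4 → ℝ, G y = y 0 • (1 : Matrix (Fin 3) (Fin 3) ℝ) + y 1 • !![(1 : ℝ), 0, 0; 0, 0, 0; 0, 0, 0] +
              y 2 • !![0, α, 0; α, 1, 0; 0, 0, -1] + y 3 • !![0, β, γ; β', 0, 1; γ', 1, 0]) ∨
          (∃ a β γ : ℝ, 0 ≤ a ∧ a ≤ 1 ∧ β ^ 2 ≤ 8 * γ ∧
            ∀ y : Fin 4 → ℝ, G y = y 0 • (1 : Matrix (Fin 3) (Fin 3) ℝ) + y 1 • !![(1 : ℝ), 0, 0; 0, 0, 0; 0, 0, 0] +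
              y 2 • !![(0 : ℝ), 1, 0; 1, 0, 1; 0, 0, 0] + y 3 • !![0, β, -γ; β * (1 - a), 1, 0; -2 * a, 0, -1]) ∨
          (∃ s₁ s₂ s₃ b₀ b₁ b₂ : ℝ, s₁ ≤ s₂ ∧ s₂ ≤ s₃ ∧ s₁ ≤ b₁ ∧ b₁ ≤ s₂ ∧ s₂ ≤ b₂ ∧ b₂ ≤ s₃ ∧
            ∀ y : Fin 4 → ℝ, G y = y 0 • (1 : Matrix (Fin 3) (Fin 3) ℝ) + y 1 • !![(0 : ℝ), 1, 0; 0, 0, 1; 0, 0, 0] +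
              y 2 • !![0, s₁ * s₂ + s₂ * s₃ + s₃ * s₁, -(s₁ * s₂ * s₃); -1, s₁ + s₂ + s₃, 0; 0, 1, 0] + y 3 • !![0, b₀ * (b₁ + b₂), -(b₀ * b₁ * b₂); 0, b₀, 0; 0, 0, 0]) ∨
          (∃ a γ δ : ℝ, 1 ≤ 2 * a ∧ 0 ≤ 1 + 2 * γ ∧ δ ^ 2 ≤ (2 * a - 1) * (1 + 2 * γ) ∧
            ∀ y : Fin 4 → ℝ, G y = y 0 • (1 : Matrix (Fin 3) (Fin 3) ℝ) + y 1 • !![(1 : ℝ), 0, 0; 0, 0, 1; 0, 0, 0] +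
              y 2 • !![2 * a - 1, 1, -a; a, 0, 0; -1, 0, 0] + y 3 • !![2 * δ, 1, γ - δ; γ + δ, 1, 0; 1, 0, -1]) ∨
          (∃ a ρ σ : ℝ, 1 ≤ 2 * a ∧ ρ ^ 2 + σ ^ 2 ≤ (2 * a - 1) ^ 2 ∧
            ∀ y : Fin 4 → ℝ, G y = y 0 • (1 : Matrix (Fin 3) (Fin 3) ℝ) + y 1 • !![(1 : ℝ), 0, 0; 0, 0, 1; 0, 0, 0] +
              y 2 • !![ρ, 1, -a; a, 0, 0; -1, 0, 0] + y 3 • !![σ, 0, 0; 0, 1, 0; 0, 0, -1]) ∨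
          (∃ a b γ δ : ℝ, 0 < b ∧ b < 1 ∧ 0 ≤ a * b + γ ∧
            (γ + (1 - a) * b) ^ 2 + b ^ 2 * δ ^ 2 ≤ b ^ 2 * (a * b + γ) ^ 2 ∧
            ∀ y : Fin 4 → ℝ, G y = y 0 • (1 : Matrix (Fin 3) (Fin 3) ℝ) + y 1 • !![(1 : ℝ), 0, 0; 0, 0, 1; 0, 0, 0] +
              y 2 • !![(1 - 1 / b ^ 2) * γ + a * b + (a - 1) / b, 1, -a; a, 0, 0; -1, 0, 0] + y 3 • !![(b + 1 / b) * δ, b, γ - δ; γ + δ, 1, 0; b, 0, -1]))) →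
    ∀ (n : ℕ) (P : (Fin n → ℝ) →ₗ[ℝ] Matrix (Fin 3) (Fin 3) ℝ),
      (∀ (x : Fin n → ℝ) (z : ℂ),
        ((P x).map (algebraMap ℝ ℂ) - z • (1 : Matrix (Fin 3) (Fin 3) ℂ)).det = 0 → z.im = 0) →
      (∀ W : Submodule ℝ (Fin 3 → ℝ), (∀ (x : Fin n → ℝ), ∀ v ∈ W, Matrix.mulVec (P x) v ∈ W) →
        W = ⊥ ∨ W = ⊤) →
      (¬ ∃ S : Matrix (Fin 3) (Fin 3) ℝ, S.PosDef ∧ ∀ x : Fin n → ℝ, (S * P x).IsSymm) →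
      3 < Module.finrank ℝ (Submodule.span ℝ
        (insert (1 : Matrix (Fin 3) (Fin 3) ℝ) (Set.range P))) →
      Literature.AlgebraicGeometry.HyperbolicPolynomials.IsSpectrahedralShadowOfSize
        {x : Fin n → ℝ | ∀ τ : ℝ, 0 < τ → (P x + τ • (1 : Matrix (Fin 3) (Fin 3) ℝ)).det ≠ 0} 6 :=
  Summit.ValiantsHypothesis.ValiantsHypothesis.Theorems.stub_highEff_N3_of_oshimeClassification

/-- stub B′ (irreducible real-spectrum shadow) — now DERIVED (sorry-free here) from the c3 stubs:
the Helton–Vinnikov layer (stubs T, L, S glued by G: dimension of `span (1, range P)` at most `3`,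
cone = spectrahedron of size `N ≤ 2^((log₂ N + c + 1)^(c+1))`) and the high layer (stub H).
For an absolute `c`, every linear pencil of real `N × N` matrices with only real eigenvalues which
is IRREDUCIBLE and NOT simultaneously symmetrisable has a "nonnegative spectrum" cone
`{x : ∀ τ > 0, det (P x + τ·1) ≠ 0}` that is a lifted-LMI set of size `≤ 2^((log₂ N + c)^c)`.
[difficulty: open-problem — = stub H ∪ Helton–Vinnikov] -/
theorem stub_realSpectrumShadow_irreducible :
    ∃ c : ℕ, ∀ (n N : ℕ) (P : (Fin n → ℝ) →ₗ[ℝ] Matrix (Fin N) (Fin N) ℝ),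
      (∀ (x : Fin n → ℝ) (z : ℂ),
        ((P x).map (algebraMap ℝ ℂ) - z • (1 : Matrix (Fin N) (Fin N) ℂ)).det = 0 → z.im = 0) →
      (∀ W : Submodule ℝ (Fin N → ℝ), (∀ (x : Fin n → ℝ), ∀ v ∈ W, Matrix.mulVec (P x) v ∈ W) →
        W = ⊥ ∨ W = ⊤) →
      (¬ ∃ S : Matrix (Fin N) (Fin N) ℝ, S.PosDef ∧ ∀ x : Fin n → ℝ, (S * P x).IsSymm) →
      ∃ m ≤ 2 ^ ((Nat.log 2 N + c) ^ c),
        Literature.AlgebraicGeometry.HyperbolicPolynomials.IsSpectrahedralShadowOfSize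
          {x : Fin n → ℝ | ∀ τ : ℝ, 0 < τ → (P x + τ • (1 : Matrix (Fin N) (Fin N) ℝ)).det ≠ 0} m := by
  obtain ⟨c, hc⟩ := stub_realSpectrumShadow_irreducible_highEff
  refine ⟨c + 1, fun n N P hP hirr hns => ?_⟩
  -- monotonicity of the bound in `c`, and `N ≤ 2^((log₂ N + c + 1)^(c+1))`
  have hmono : 2 ^ ((Nat.log 2 N + c) ^ c) ≤ 2 ^ ((Nat.log 2 N + (c + 1)) ^ (c + 1)) := by
    apply Nat.pow_le_pow_right (by norm_num)
    calc (Nat.log 2 N + c) ^ c ≤ (Nat.log 2 N + (c + 1)) ^ c := Nat.pow_le_pow_left (by omega) c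
      _ ≤ (Nat.log 2 N + (c + 1)) ^ (c + 1) := Nat.pow_le_pow_right (by omega) (by omega)
  have hN : N ≤ 2 ^ ((Nat.log 2 N + (c + 1)) ^ (c + 1)) := by
    have h1 : N < 2 ^ (Nat.log 2 N + 1) := Nat.lt_pow_succ_log_self (by norm_num) N
    have h2 : Nat.log 2 N + 1 ≤ (Nat.log 2 N + (c + 1)) ^ (c + 1) :=
      (by omega : Nat.log 2 N + 1 ≤ Nat.log 2 N + (c + 1)).trans (Nat.le_self_pow (by omega) _)
    exact h1.le.trans (Nat.pow_le_pow_right (by norm_num) h2)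
  rcases le_or_gt (Module.finrank ℝ (Submodule.span ℝ
      (insert (1 : Matrix (Fin N) (Fin N) ℝ) (Set.range P)))) 3 with hlow | hhigh
  · -- Helton–Vinnikov layer: a genuine spectrahedron of size `N`
    exact ⟨N, hN, stub_lowEff_glue stub_ternaryPencil_hyperbolicForm stub_laxConjecture
      stub_spectrahedron_of_symmDetIdentity n N P hP hlow⟩
  · -- high layer (then `3 ≤ N` by stub D₂): the open stub
    have hN3 : 3 ≤ N := by
      by_contra hlt
      exact absurd hhigh (not_lt.2 (stub_spanDim_le_three_of_le_two n N P (by omega) hP))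
    obtain ⟨m, hm, h⟩ := hc n N P hP hirr hns hhigh hN3
    exact ⟨m, hm.trans hmono, h⟩

/-- stub B (real-spectrum shadow) — now DERIVED (sorry-free here) from stub B′ through the landed
reduction `permanentalCones_realSpectrumShadow_of_irreducible_nonsymmetrizable` (p151086): for an
absolute `c`, every linear space of real `N × N` matrices with only real eigenvalues has a
"nonnegative spectrum" cone `{x : ∀ τ > 0, det (P x + τ·1) ≠ 0}` that is a spectrahedral shadow
of size `≤ 2^((log₂ N + c)^c)`. [difficulty: open-problem — = crux #3 `HyperbolicDetShadow`] -/
theorem stub_realSpectrumShadow :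
    ∃ c : ℕ, ∀ (n N : ℕ) (P : (Fin n → ℝ) →ₗ[ℝ] Matrix (Fin N) (Fin N) ℝ),
      (∀ (x : Fin n → ℝ) (z : ℂ),
        ((P x).map (algebraMap ℝ ℂ) - z • (1 : Matrix (Fin N) (Fin N) ℂ)).det = 0 → z.im = 0) →
      ∃ m ≤ 2 ^ ((Nat.log 2 N + c) ^ c),
        ∃ (p : ℕ) (A : (Fin n → ℝ) × (Fin p → ℝ) →ₗ[ℝ] Matrix (Fin m) (Fin m) ℝ)
          (B : Matrix (Fin m) (Fin m) ℝ), ∀ x : Fin n → ℝ,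
          (∀ τ : ℝ, 0 < τ → (P x + τ • (1 : Matrix (Fin N) (Fin N) ℝ)).det ≠ 0) ↔
            ∃ y : Fin p → ℝ, (A (x, y) + B).PosSemidef :=
  Summit.ValiantsHypothesis.ValiantsHypothesis.Theorems.permanentalCones_realSpectrumShadow_of_irreducible_nonsymmetrizable
    stub_realSpectrumShadow_irreducible

/-- Composition lemma (sorry-free, axioms ⊆ {propext, Classical.choice, Quot.sound}):
stub A → stub B → the crux statement. The conclusion is the text of
`Theses.PermanentalCones.HyperbolicVPShadow` VERBATIM (kept unfolded on purpose: the skeleton audit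
must see exactly one theorem concluding the crux by name, `HyperbolicVPShadow_of` below, which is
this lemma applied to the two stubs). Route: `VP_ℂ ⇒ dc` quasi-polynomial (tree facts), realification
of the complex pencil (`f_n · f_n = det` of a real `2N × 2N` affine pencil, landed with `DetToVP`),
stub A at `(f_n · f_n, e_n)`, stub B, and `(log₂ (2N) + c)^c ≤ (log₂ n + c')^{c'}`,
`c' = (a+1)(c+1)+a+c+2`. -/
theorem hyperbolicVPShadow_of_stubs
    (hA : (∀ (n N : ℕ) (g : MvPolynomial (Fin n) ℝ) (M : Matrix (Fin N) (Fin N) (MvPolynomial (Fin n) ℝ))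
      (e : Fin n → ℝ), IsAffineDetRepr g M → (∃ d : ℕ, g.IsHomogeneous d) →
      (MvPolynomial.eval e g ≠ 0 ∧ ∀ (x : Fin n → ℝ) (z : ℂ),
        MvPolynomial.eval (fun j => (x j : ℂ) + z * (e j : ℂ))
          (MvPolynomial.map (algebraMap ℝ ℂ) g) = 0 → z.im = 0) →
      ∃ P : (Fin n → ℝ) →ₗ[ℝ] Matrix (Fin N) (Fin N) ℝ,
        (∀ (x : Fin n → ℝ) (z : ℂ),
          ((P x).map (algebraMap ℝ ℂ) - z • (1 : Matrix (Fin N) (Fin N) ℂ)).det = 0 → z.im = 0) ∧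
        ∀ x : Fin n → ℝ, (∀ τ : ℝ, 0 < τ → MvPolynomial.eval (x + τ • e) g ≠ 0) ↔
          ∀ τ : ℝ, 0 < τ → (P x + τ • (1 : Matrix (Fin N) (Fin N) ℝ)).det ≠ 0))
    (hB : (∃ c : ℕ, ∀ (n N : ℕ) (P : (Fin n → ℝ) →ₗ[ℝ] Matrix (Fin N) (Fin N) ℝ),
      (∀ (x : Fin n → ℝ) (z : ℂ),
        ((P x).map (algebraMap ℝ ℂ) - z • (1 : Matrix (Fin N) (Fin N) ℂ)).det = 0 → z.im = 0) →
      ∃ m ≤ 2 ^ ((Nat.log 2 N + c) ^ c),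
        ∃ (p : ℕ) (A : (Fin n → ℝ) × (Fin p → ℝ) →ₗ[ℝ] Matrix (Fin m) (Fin m) ℝ)
          (B : Matrix (Fin m) (Fin m) ℝ), ∀ x : Fin n → ℝ,
          (∀ τ : ℝ, 0 < τ → (P x + τ • (1 : Matrix (Fin N) (Fin N) ℝ)).det ≠ 0) ↔
            ∃ y : Fin p → ℝ, (A (x, y) + B).PosSemidef)) :
    ∀ (v : ℕ → ℕ) (f : ∀ n : ℕ, MvPolynomial (Fin (v n)) ℝ) (e : ∀ n : ℕ, Fin (v n) → ℝ),
      IsVPFamily (fun n => MvPolynomial.map (algebraMap ℝ ℂ) (f n)) →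
      (∀ n, ∃ d : ℕ, (f n).IsHomogeneous d) →
      (∀ n, MvPolynomial.eval (e n) (f n) ≠ 0 ∧ ∀ (x : Fin (v n) → ℝ) (z : ℂ),
        MvPolynomial.eval (fun j => (x j : ℂ) + z * (e n j : ℂ))
          (MvPolynomial.map (algebraMap ℝ ℂ) (f n)) = 0 → z.im = 0) →
      ∃ c : ℕ, ∀ n : ℕ, ∃ m ≤ 2 ^ ((Nat.log 2 n + c) ^ c),
        ∃ (p : ℕ) (A : (Fin (v n) → ℝ) × (Fin p → ℝ) →ₗ[ℝ] Matrix (Fin m) (Fin m) ℝ)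
          (B : Matrix (Fin m) (Fin m) ℝ), ∀ x : Fin (v n) → ℝ,
          (∀ τ : ℝ, 0 < τ → MvPolynomial.eval (x + τ • e n) (f n) ≠ 0) ↔
            ∃ y : Fin p → ℝ, (A (x, y) + B).PosSemidef := by
  intro v f e hVP hhom hhyp
  obtain ⟨c, hc⟩ := hB
  -- quasi-polynomial determinantal complexity of the complexified family (tree fact)
  obtain ⟨a, ha⟩ := isQPBounded_determinantalComplexity_of_isVPFamily_holds
    (k := ℂ) (σ := fun n => Fin (v n)) (fun n => MvPolynomial.map (algebraMap ℝ ℂ) (f n)) hVP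
  refine ⟨(a + 1) * (c + 1) + a + c + 2, fun n => ?_⟩
  set N := determinantalComplexity (MvPolynomial.map (algebraMap ℝ ℂ) (f n)) with hN
  have hNle : N ≤ 2 ^ ((Nat.log 2 n + a) ^ a) := ha n
  -- a real affine pencil of size 2N for f_n * f_n (realification, landed with DetToVP)
  obtain ⟨M, hM⟩ :=
    Summit.ValiantsHypothesis.ValiantsHypothesis.Theorems.permanentalCones_hasDetRepr_mul_self_of_complex
      (f n) (hasDetRepr_determinantalComplexity_holds _)
  have hhom2 : ∃ d : ℕ, (f n * f n).IsHomogeneous d := by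
    obtain ⟨d, hd⟩ := hhom n
    exact ⟨d + d, hd.mul hd⟩
  have hhyp2 : MvPolynomial.eval (e n) (f n * f n) ≠ 0 ∧
      ∀ (x : Fin (v n) → ℝ) (z : ℂ), MvPolynomial.eval (fun j => (x j : ℂ) + z * (e n j : ℂ))
        (MvPolynomial.map (algebraMap ℝ ℂ) (f n * f n)) = 0 → z.im = 0 := by
    refine ⟨?_, fun x z hz => (hhyp n).2 x z ?_⟩
    · rw [map_mul]
      exact mul_ne_zero (hhyp n).1 (hhyp n).1
    · rw [map_mul, map_mul] at hz
      exact mul_self_eq_zero.1 hz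
  -- stub A: linear real-spectrum pencil with the same closed cone; stub B: its shadow
  obtain ⟨P, hPreal, hPcone⟩ := hA (v n) (2 * N) (f n * f n) M (e n) hM hhom2 hhyp2
  obtain ⟨m, hm, p, A, B, hrep⟩ := hc (v n) (2 * N) P hPreal
  refine ⟨m, hm.trans ?_, p, A, B, fun x => ?_⟩
  · -- compose the two quasi-polynomial bounds
    apply Nat.pow_le_pow_right (by norm_num)
    set L := Nat.log 2 n with hL
    set t := L + a + c + 2 with ht
    have hlog : Nat.log 2 (2 * N) ≤ (L + a) ^ a + 1 := by
      calc Nat.log 2 (2 * N) ≤ Nat.log 2 (2 * 2 ^ ((L + a) ^ a)) :=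
            Nat.log_mono_right (Nat.mul_le_mul_left 2 hNle)
        _ = (L + a) ^ a + 1 := by
            rw [← Nat.pow_succ', Nat.log_pow (by norm_num)]
    have hbase : (L + a) ^ a + 1 + c ≤ t ^ (a + 1) := by
      rcases Nat.eq_zero_or_pos a with rfl | hapos
      · simp only [add_zero, pow_zero, zero_add, pow_one, ht]
        omega
      · have h1 : (L + a) ^ a ≤ t ^ a := Nat.pow_le_pow_left (by omega) a
        have h2 : t ≤ t ^ a := Nat.le_self_pow (by omega) t
        have h3 : t ^ (a + 1) = t ^ a * t := pow_succ t a
        have h4 : 2 ≤ t := by omega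
        nlinarith
    calc (Nat.log 2 (2 * N) + c) ^ c ≤ ((L + a) ^ a + 1 + c) ^ c :=
          Nat.pow_le_pow_left (by omega) c
      _ ≤ (t ^ (a + 1)) ^ c := Nat.pow_le_pow_left hbase c
      _ = t ^ ((a + 1) * c) := by rw [← Nat.pow_mul]
      _ ≤ (L + ((a + 1) * (c + 1) + a + c + 2)) ^ ((a + 1) * c) :=
          Nat.pow_le_pow_left (by rw [ht]; nlinarith) _
      _ ≤ (L + ((a + 1) * (c + 1) + a + c + 2)) ^ ((a + 1) * (c + 1) + a + c + 2) :=
          Nat.pow_le_pow_right (by omega) (by nlinarith)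
  · -- closed cone of f_n = closed cone of f_n * f_n = "no negative eigenvalue" cone of P
    refine Iff.trans (forall_congr' fun τ => ?_) ((hPcone x).trans (hrep x))
    rw [map_mul]
    exact imp_congr_right fun _ => mul_self_ne_zero.symm

/-- **Skeleton theorem** (BC3): the crux `HyperbolicVPShadow` BY NAME from the declared stubs —
after the c3 reshape `sorry` occurs only inside the registered stubs T
(`stub_ternaryPencil_hyperbolicForm`), L (`stub_laxConjecture`), S
(`stub_spectrahedron_of_symmDetIdentity`), G (`stub_lowEff_glue`) and H
(`stub_realSpectrumShadow_irreducible_highEff`); stub A landed p143589, stub B is derived from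
stub B′ by the landed reduction p151086, and stub B′ from T, L, S, G, H above. -/
theorem HyperbolicVPShadow_of : HyperbolicVPShadow :=
  hyperbolicVPShadow_of_stubs stub_linearRealSpectrumNormalForm stub_realSpectrumShadow

end Summit.ValiantsHypothesis.ValiantsHypothesis.Cruxes.HyperbolicVPShadow.Birth
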